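import Mathlib
import HarnessLib
import HarnessLib.Audit
import Summits.ABC.ABC.Theses.IneffectiveSubspace
import Literature.NumberTheory.DiophantineGeometry.AbcWave0
import Summits.ABC.ABC.Theorems.IneffectiveSubspaceDepthCountedABCStubDictionary
import Summits.ABC.ABC.Theorems.IneffectiveSubspaceDepthCountedABCStubBase
import Summits.ABC.ABC.Theorems.IneffectiveSubspaceDepthCountedABCStubAssembly
import Summits.ABC.ABC.Theorems.IneffectiveSubspaceDepthCountedABCStubBoundedRadicalCell
import Summits.ABC.ABC.Theorems.IneffectiveSubspaceDepthCountedABCStubRoughPowerfulCellIff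
import Summits.ABC.ABC.Theorems.IneffectiveSubspaceDepthCountedABCStubRidoutSmallMember
import Summits.ABC.ABC.Theorems.IneffectiveSubspaceDepthCountedABCStubLwDeepDictionary
import Summits.ABC.ABC.Theorems.IneffectiveSubspaceDepthCountedABCRidoutLocalisation
import Summits.ABC.ABC.Theorems.IneffectiveSubspaceDepthCountedABCRidoutLocalisationAbc
import Summits.ABC.ABC.Theorems.IneffectiveSubspaceDepthCountedABCStubCellZeroQuarticThue
import Summits.ABC.ABC.Theorems.IneffectiveSubspaceDepthCountedABCStubQuarticThueOfCellZero
import Summits.ABC.ABC.Theorems.IneffectiveSubspaceDepthCountedABCStubCellTwoPillai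
import Summits.ABC.ABC.Theorems.IneffectiveSubspaceDepthCountedABCStubCellOneCases
import Summits.ABC.ABC.Theorems.IneffectiveSubspaceDepthCountedABCStubCellOneThueMahler
import Summits.ABC.ABC.Theorems.IneffectiveSubspaceTowerFourGivesDepthCounted
import Summits.ABC.ABC.Theorems.IneffectiveSubspaceDepthCountedABCCertificatesCores
import Summits.ABC.ABC.Theorems.IneffectiveSubspaceDepthCountedABCCertificatesDictionary
import Summits.ABC.ABC.Theorems.IneffectiveSubspaceDepthCountedABCStubS4SmallMemberOfTowerFour
import Summits.ABC.ABC.Theorems.IneffectiveSubspaceDepthCountedABCStubQuarticThueWindow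
import Summits.ABC.ABC.Theorems.IneffectiveSubspaceDepthCountedABCStubQuarticThueSharp
import Summits.ABC.ABC.Theorems.IneffectiveSubspaceDepthCountedABCStubThueMahlerWindow
import Summits.ABC.ABC.Theorems.IneffectiveSubspaceDepthCountedABCStubPillaiWindow
import Summits.ABC.ABC.Theorems.IneffectiveSubspaceDepthCountedABCStubCellZeroLittleO
import Summits.ABC.ABC.Theorems.IneffectiveSubspaceDepthCountedABCStubCellOneLittleO
import Summits.ABC.ABC.Theorems.IneffectiveSubspaceDepthCountedABCStubTowerFourIffUniformQuarticThue
import Summits.ABC.ABC.Theorems.IneffectiveSubspaceDepthCountedABCStubThueOfCellZeroLittleO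
import Summits.ABC.ABC.Theorems.IneffectiveSubspaceDepthCountedABCStubThueMahlerOfCellOneLittleO
import Summits.ABC.ABC.Theorems.IneffectiveSubspaceDepthCountedABCStubCellZeroSparseExceptions
import Summits.ABC.ABC.Theorems.IneffectiveSubspaceDepthCountedABCStubCellZeroIffUniformQuarticThueCell

/-!
# Line `Sketch` — crux `IneffectiveSubspace.DepthCountedABC` (stmt-ABC-14938) — skeleton v3

STATUS v3·c23 (lead c23 `prover-line-stmt-ABC-14938-c23-0`, 2026-08-17): skeleton re-checked against the current tree (farm rc 0,
errors [], `sorry` in exactly the three cores) and re-registered with FOUR new certificate stubs (22–25), all theorems of the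
tree (no unproved fact), ALL LANDED in the c23 wave (p160408 / p160878 / p161405 / p161590) and imported below, plus wave 2
(Stub 26 `stub_thueMahlerOfCellOneLittleO` p162369 — the cell-1 converse, so that on BOTH shallow cells "free exponent improved by
`o(1)`" ⟺ the ineffective finiteness theorem fibrewise; Stub 27 `stub_cellZeroSparseExceptions` p162960 — the 5-free exceptions to
`2 − δ` number `≤ 1156·N^(1/4+16δ)` up to `N`, unconditionally) and wave 3 (Stub 28 `stub_cellZeroIffUniformQuarticThueCell` p164544 and
Stub 29 `stub_cellOneIffUniformQuarticThueMahlerCell` p165256 — the first `δ` below the free exponent of each shallow cell is an EXACT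
equivalence with the cell-restricted uniform Thue / Thue–Mahler statement, closing the one-sided c19 pairs 13/14 and 17/—), so `sorry`
again occurs ONLY in the three cores.  NEW IN c23 — what the INEFFECTIVE
Thue–Siegel–Roth–Ridout machinery, all of it PROVED in the tree (`roth_holds`, `Ridout.padicRoth_int`,
`BugeaudEvertseGyory2018_SPartPolynomialValues_holds`), yields on the shallow cells, unconditionally, and where the cell-0 entry
sub-crux of c19/c22 sits in the route: Stub 22 `stub_cellZeroLittleO` — `c = o(rad²)` on the 5-free cell (Roth over the finite box
of binomial quartic forms left by `quarticThue_natBounds` when `c ≥ κ·rad²`); Stub 23 `stub_cellOneLittleO` — `c = o(rad⁴)` on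
`ω₅ ≤ 1` (the c19 case analysis leaves a finite box of binomial quartic Thue–Mahler data, each bounded by the S-part theorem
`[X⁴ ∓ m]_p ≤ C|·|^(1/4+ε)` = Ridout); Stub 24 `stub_towerFourIffUniformQuarticThue` — `TowerFourSubLiouville ↔ ∃ η > 0,
UniformQuarticThue η` through crux #4's landed `stub_cruxGivesUBQ` / `stub_transfer`, so that `TowerFourSubLiouville → ∃ δ > 0,
CellZeroExponent (2 − δ)` (`cellZero_of_towerFourSubLiouville`): the entry-level sub-crux of cell 0 IS crux #4 (stmt-ABC-1649), not
a new item; Stub 25 `stub_thueOfCellZeroLittleO` — the converse of Stub 22 on the cell, so that on cell 0 "free exponent 2 improved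
by `o(1)`" ⟺ Thue fibrewise (a theorem), "`2 − δ`" ⟺ uniform Thue ⟺ crux #4 (open), "`1 + δ`" = the core.  The three cores are
untouched (open-problem grade, each ⟸ ABC, each ⟸ crux #2 via `openStubs_of_towerFour`); outcome stays `blocked-on: stmt-ABC-14937`.
c22 header follows.

STATUS v3·c22 (lead c22 `prover-line-stmt-ABC-14938-c22-0`, 2026-08-17): skeleton re-checked against the current tree (farm rc 0,
errors [], `sorry` in exactly the three cores `stub_LW4`, `stub_deepSmallFullSize`, `stub_allPowerRich`) and re-registered; crux #2
stmt-ABC-14937 still OPEN (attempts 3, collapsed mod #6 to `BoundedOmegaABC` by its own leads), Disproof v4 unchanged.  NEW IN c22 —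
the WINDOWS OF THE THREE ENTRY-LEVEL SUB-CRUXES of the c19 frontier, as registered certificate Stubs 18–20 (each a pair
"implied by `ABC` on a range" / "false beyond a threshold", so that a planner promoting a sub-crux knows exactly which parameter to file):
Stub 18 `stub_quarticThueWindow`: `ABC ⟹ UniformQuarticThue η` for `0 < η < 8/5`, and `UniformQuarticThue η` is FALSE for every
`η > 2` (good rational approximations `p/d` of `2^(1/4)`, Dirichlet: `|p⁴ − 2d⁴| < 65·d²`, arranged as `a + uY⁴ = vZ⁴` with
`uv ∈ {2, 8}` according to the parity of `p`); Stub 21 `stub_quarticThueSharp` then closes the gap: keeping the cofactor `v` of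
`c = vZ⁴` (`Y ≤ v^(1/4)Z`) gives `ABC ⟹ UniformQuarticThue η` for EVERY `η < 2`, so the cell-0 sub-crux is SHARP at `η = 2`
(decided by `ABC` on `(0,2)`, refuted on `(2,∞)`; the heuristic count `Σ_{u,v} N^(η−2)·u^(−5/4)·v^(−7/4)` agrees).  Stub 19 `stub_thueMahlerWindow`: `ABC ⟹ UniformQuarticThueMahler η` for
`0 < η < 3`, and BOTH Thue–Mahler shapes are FALSE for every `η > 3` (`(2^m+1)⁴ − 2^(4m) ≤ 15·2^(3m)`, `2^(4m) − (2^m−1)⁴ ≤ 8·2^(3m)`)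
— a SHARP threshold.  Stub 20 `stub_pillaiWindow`: `ABC ⟹ PolyPillai N` for every `N ≥ 2`, and `PolyPillai N` is FALSE for `N ≤ 1`
(`1 + 3^(k+1)·u = 4^(3^k)`, `3^(k+1) ∣ 4^(3^k) − 1`) — SHARP over `ℕ`.  The cores are untouched (open-problem grade, each ⟸ ABC and
⟸ crux #2 via `openStubs_of_towerFour`); Stubs 18–21 LANDED in cycle 22 (p157260 / p157144 / p157002 / p157829) and are imported below, so
`sorry` again occurs ONLY in the three cores; outcome `blocked-on: stmt-ABC-14937`.  c20 header follows.

STATUS v3·c20 (lead c20 `prover-line-stmt-ABC-14938-c20-0`, 2026-08-17): skeleton re-checked against the current tree (farm rc 0,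
errors [], `sorry` in exactly the three cores `stub_LW4`, `stub_deepSmallFullSize`, `stub_allPowerRich`; `depthCountedABC_from_stubs`
= audit class `proof-of-item` for the crux BY NAME) and re-registered.  Fifth consecutive lead (c15, c17, c18, c19, c20) with 0
delegable stubs (`wave: none`).  NEW IN c20 — the DOMINATION BY CRUX #2 is now part of the skeleton itself, kernel-checked, not prose
(section "v3·c20" at the end of the file): `towerFour_dominates_crux : TowerFourGivesDepthCounted` (`= UniformSadicTowerFour →
DepthCountedABC`, the tree-proved dictionary `Summit.ABC.ABC.Theorems.towerFourGivesDepthCounted_proof`, stmt-ABC-14940),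
`openStubs_of_towerFour : UniformSadicTowerFour → LW4 ∧ SmallFullSizeDeep ∧ AllPowerRich` (composition of the landed certificates
p101075 → p98807 and p99305) and `towerFour_dominates_line` (the same cores fed back through `DepthCountedABC_of`): every OPEN stub of
this line, and the crux, is closed by the single registered item stmt-ABC-14937 (crux #2, OPEN, lead c3 active) — which is exactly the
content of the outcome `blocked-on: stmt-ABC-14937`; the file's only `proof-of-item` remains `depthCountedABC_from_stubs` (closed=false).  Conversely nothing weaker than #2-strength input is known
to move any core (c19 per-cell frontier below: cell 0 `2−δ` ⟺ uniform binomial quartic Thue; cell 1 `4−δ` ⟸ uniform quartic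
Thue–Mahler; cell 2 polynomial ⟺ polynomial generalized Pillai; cells ≥ 3 Stewart–Yu).  c19 header follows.

STATUS v3·c19 (lead c19 `prover-line-stmt-ABC-14938-c19-0`, 2026-08-17): skeleton re-checked UNCHANGED against the current tree
(farm rc 0, errors [], `sorry` in exactly the three cores `stub_LW4`, `stub_deepSmallFullSize`, `stub_allPowerRich`;
`depthCountedABC_from_stubs` = audit class `proof-of-item` for the crux BY NAME) and re-registered.  Fourth consecutive lead (c15, c17,
c18, c19) with 0 delegable stubs: `wave: none — 0 provable stubs; the 3 open stubs are open-problem grade (each ⟸ ABC)`.  NEW IN c19 —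
THE WEAKEST OPEN FACE OF CELL 0 (certificate Stubs 13 `stub_cellZeroOfUniformQuarticThue` and 14 `stub_uniformQuarticThueOfCellZero`, LANDED p148304/p148305): the trivial exponent on the 5-free cell is 2
(`c < √2·rad(abc)²`, Disproof §C `cellZero_exponent_two`), the stub asks `1+δ`; but already the FIRST improvement
`∃ δ > 0, c < C·rad(abc)^(2−δ)` on cell 0 is EQUIVALENT (δ ↔ η bookkeeping: `⟸` with `δ = η/(16+4η)`, `⟹` with `η < 4δ/5` on the
squarefree-coprime locus) to the finiteness of the coprime solutions of the binomial quartic Thue inequality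
`0 < v·Z⁴ − u·Y⁴ = a` with `a·u·v ≤ Z^η` — i.e. to a bound, POLYNOMIAL AND UNIFORM in the coefficients `(a,u,v)`, on the size of the
SMALLEST solution of `vZ⁴ − uY⁴ = a` (derivation: `c ≥ rad^(2−δ)` forces `a < 2·rad^(2δ)` and defects `D(b)D(c) < 2·rad^(2δ)`,
`D(n) := rad(n)⁴/n`, whence `b = uY⁴`, `c = vZ⁴` with `uv ≤ (D(b)D(c))³`).  Thue–Siegel / hypergeometric methods (Siegel 1937,
Evertse 1982, Bennett 2001) bound the NUMBER of large solutions per coefficient class (by 1 when `uv ≫ a⁶`) but never the size of the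
first; Baker/Bombieri effective measures bound the size only as `exp(poly(a,u,v))`; effective Padé measures (Baker 1964,
Bombieri–Mueller 1983, Bennett 1997) need `v/u` multiplicatively close to 1.  So not even `2 − δ` is available on cell 0 by any method
in print, and the line's cores (`1 + δ`) a fortiori.  CELL 1 (certificate Stubs 16 `stub_cellOneCases`, 17
`stub_cellOneOfUniformQuarticThueMahler`, LANDED p149866/p150672): free exponent 4; the first `δ` below 4
follows from uniform binomial quartic Thue–MAHLER (`a + p^k·u = v·Z⁴` / `a + u·Y⁴ = p^w·v` with `a·u·v·p ≤ Z^η` resp. `Y^η`).  CELL 2 (certificate Stub 15 `stub_cellTwoOfPolyPillai`, LANDED p148454): no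
polynomial exponent at all is in print on `ω₅ ≤ 2`; every placement of the two deep primes is elementary (`c ≤ 2rad⁸`) except the
generalized Pillai configuration `a + r^v·u = s^w·v'` (deep `r ∣ b`, `s ∣ c`, `a² < c`), and `PolyPillai N ⟹` exponent `14N+8` on
the cell (converse immediate) — linear forms in logarithms give this configuration only quasi-polynomially
(`c ≤ exp(O(log³rad·log log rad))`, Matveev with the 3 logarithms `r, s, v'/u`) and are exhausted at `r, s ≈ e^√(log c)`; the item stays parked on crux #2 (`blocked-on: stmt-ABC-14937`, OPEN, attempts 3,
unchanged since c18), through which `IneffectiveSubspace.closes` already derives it (`towerFourGivesDepthCounted_proof`, stmt-ABC-14940).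
c18 header follows.

STATUS v3·c18 (lead c18 `prover-line-stmt-ABC-14938-c18-0`, 2026-08-17): skeleton re-checked UNCHANGED against the current
tree (farm; `sorry` in exactly the three cores `stub_LW4`, `stub_deepSmallFullSize`, `stub_allPowerRich`; `depthCountedABC_from_stubs`
concludes the crux BY NAME) and re-registered by lead c18.  Audit of c18 (third consecutive lead to find 0 delegable stubs): the three
open stubs are the crux restricted to its three cells, each implied by `ABC` (Disproof §A, p98807/p99305) and none supplied by any
`Leans on:` of the line or by any theorem in the tree or in print; the crux itself is DERIVED from crux #2 `UniformSadicTowerFour`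
inside `IneffectiveSubspace.closes` through the tree-proved dictionary `Summit.ABC.ABC.Theorems.towerFourGivesDepthCounted_proof`
(stmt-ABC-14940), so the item is parked on #2 (`blocked-on: stmt-ABC-14937`), exactly as lead c17 concluded.  c17 header follows.

STATUS v3·c17 (lead c17 `prover-line-stmt-ABC-14938-c17-0`, 2026-08-17): skeleton re-checked UNCHANGED against the current
tree (farm rc 0; `sorry` in exactly the three cores `stub_LW4`, `stub_deepSmallFullSize`, `stub_allPowerRich`;
`depthCountedABC_from_stubs` concludes the crux BY NAME) and re-registered.  No stub of this line is provable without
abc-strength input (c15 finding, re-audited by c17: each core is implied by `ABC`, the two arithmetic cores by the crux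
itself — `stub_coresOfCrux`, p99305 — and `LW4 ⟺ S4SmallMemberABC ⟸ UniformSadicTowerFour`, p98807/p101075), while the
crux as a whole is CLOSED BY CRUX #2 through the tree-proved dictionary `Summit.ABC.ABC.Theorems.towerFourGivesDepthCounted_proof`
(stmt-ABC-14940).  Lead c17 therefore parks the item on #2 (`blocked-on: stmt-ABC-14937`): the line stands as the complete
map of the direct attack; nothing in it moves independently of #2-strength input.  c15 header follows.

STATUS v3·c15 (lead c15 `prover-line-stmt-ABC-14938-c15-0`, cycle 15, 2026-08-17): the wave of cycle 15 LANDED the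
last two stratum stubs — `stub_ridoutSmallMember` (`Summit.ABC.ABC.Theorems.DepthCountedABC.stub_ridoutSmallMember`,
p141112: `c ≤ C(y,δ)·(a·rough_y(bc))^(1+δ)` for EVERY abc triple, and the coefficient fibre
`rad(bc) ≤ R ⟹ c ≤ C(R,δ)·a^(1+δ)`, both unconditional from the tree-proved Ridout theorem) and `stub_lwDeepDictionary`
(`….stub_lwDeepDictionary`, p141159: Lang–Waldschmidt in `4+K` logarithms ⟹ T on the whole cell `ω₅ ≤ K`) — both now
imported, so `sorry` occurs in EXACTLY the three cores `stub_LW4`, `stub_deepSmallFullSize`, `stub_allPowerRich`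
(open-problem grade: each ⟸ ABC, Disproof.lean §A/§F; `LW4 ⟺ S4SmallMemberABC`, p98807).  Every provable stub of the
line (2, 3, 6, 7, 8, 9, 10) is landed, and the cores are LOCALISED by two landed certificate stubs (11:
`stub_ridoutLocalDeepSmallFullSizeIff`, p142136; 12: `stub_ridoutLocalAllPowerRichIff`, p141850): each core is equivalent to
its restriction to the triples whose `y`-rough powerful excess of `abc` is `≥ θ·log c`.  c14 header follows.

STATUS v3·c14 (lead c14 `prover-line-stmt-ABC-14938-c14-0`, cycle 14, 2026-08-17): two stratum stubs LANDED in cycle 10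
and are now imported — `stub_roughPowerfulCellIff` (`Summit.ABC.ABC.Theorems.DepthCountedABC.stub_roughPowerfulCellIff`,
p140411) and `stub_boundedRadicalCell` (`….stub_boundedRadicalCell`, p140359) — so `sorry` occurs in 5 stubs: the three
cores and the two remaining stratum stubs `stub_ridoutSmallMember`, `stub_lwDeepDictionary` (wave of cycle 14).
c10 header follows.

STATUS v3·c10 (lead c10 `prover-line-stmt-ABC-14938-c10-0`, cycle 10, 2026-08-17): skeleton v3 re-registered unchanged
(7 `sorry`, all in `stub_*`); cycle 10 runs ONE wave of four stub-workers on the stratum stubs 7–10 (still open: leads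
c2–c9 filed no proposals) while the lead holds the three cores (hardest `stub_LW4`) and works the Ridout reshaping of
the T cores towards skeleton v4.  c9 header follows.

STATUS v3·c9 (lead c9 `prover-line-stmt-ABC-14938-c9-0`, cycle 9, 2026-08-17): skeleton v3 re-registered unchanged
(7 `sorry`, all in `stub_*`); cycle 9 runs ONE wave of four stub-workers on the stratum stubs 7–10 (leads c2–c8 filed
no proposals, so all four are still open) while the lead holds the three cores and proves the Ridout sharpening of
the T cores (T on a cell ⟸ `RidoutSmallMember` + T on the rough-powerful-excess sub-cell) towards skeleton v4.
c8 header follows.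

STATUS v3·c8 (lead c8 `prover-line-stmt-ABC-14938-c8-0`, cycle 8, 2026-08-17): skeleton v3 re-registered unchanged
(7 `sorry`, all in `stub_*`); cycle 8 runs ONE wave of four stub-workers on the stratum stubs 7–10 while the lead
holds the three cores and proves the Ridout sharpening of the T cores.  c7 header follows.

STATUS v3·c7 (lead c7 `prover-line-stmt-ABC-14938-c7-0`, cycle 7, 2026-08-17): skeleton v3 re-registered unchanged
(7 `sorry`, all in `stub_*`); cycle 7 runs ONE wave of four stub-workers on the four stratum stubs 7–10 below while
the lead holds the three cores and proves the Ridout sharpening of the T cores (T on a cell ⟸ T on the triples whose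
`y`-rough powerful excess of `bc` is `≥ θ·log c`).  v3 header of lead c3 follows.

STATUS v3 (lead c3 `prover-line-stmt-ABC-14938-c3-0`, cycle 3, 2026-08-17).  Composition unchanged (the T/P cut;
`stub_dictionary` p96764, `stub_base` p96440, `stub_assembly` p96745 LANDED; `sorry` in the three cores `stub_LW4`,
`stub_deepSmallFullSize`, `stub_allPowerRich`, all open-problem grade).  NEW IN v3 — the RIDOUT STRATUM, unconditional
because the `p`-adic Roth theorem over `ℚ` is PROVED in the tree (`Ridout.finite_of_abs_le_one`, B–G Thm 6.2.3) and
its abc reading is LANDED for the sister crux (`Summit.ABC.ABC.Theorems.DeepRegimeABC.ridoutCoreBound_holds`: cored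
triples are bounded).  Four stratum stubs, each provable now and each landing as a `--supports` file:
* `stub_ridoutSmallMember`  — the Ridout reading of the T core: `c ≤ C(y,δ)·(a·rough_y(bc))^(1+δ)` for EVERY abc
  triple (`rough_y(bc) = ∏_{p>y} p^{v_p(bc)}`), i.e. T with `rad(bc)` replaced by the `y`-rough part of `bc`; and its
  corollary the COEFFICIENT FIBRE of T, `rad(bc) ≤ R ⟹ c ≤ C(R,δ)·a^(1+δ)`, now UNCONDITIONAL (this is
  `stub_fibreBaker`'s conclusion, p108257, without the `baker_wustholz` hypothesis).
* `stub_roughPowerfulCellIff` — the Ridout normal form of the crux: `DepthCountedABC ⟺` abc with exponent `1+ε` on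
  the cell `ω₅ ≤ K` for the triples whose `y`-rough powerful excess `Σ_{p>y, p∣abc}(v_p(abc)−1)·log p` is
  `≥ θ·log c` (`0 < θ`, `θ(1+ε) < ε`, `y, C` free) — parallel to the landed `deepRegimeABC_iff_roughPowerfulTail`.
* `stub_boundedRadicalCell` — the bounded-radical fibres: `rad(abc) ≤ R ⟹ c ≤ B(R)` (Mahler 1933 = the tree-proved
  `finite_setOf_isABCTriple_primeFactors_subset_holds`), hence abc with any exponent on `{rad(abc) ≤ R}`.
* `stub_lwDeepDictionary` (registered in cycle 1, lemmas p103330 landed, the implication itself not yet) — LW in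
  `4+K` logarithms with polynomial coefficient loss ⟹ T on the whole cell `ω₅ ≤ K`.
Previous header (v2/v1) follows.

STATUS v2 (lead, cycle 1, wave 1 returned): `stub_dictionary` CLOSED (landed
`Summit.ABC.ABC.Theorems.DepthCountedABC.stub_dictionary`, p96764), `stub_base` CLOSED (`….stub_base`, p96440),
`stub_assembly` CLOSED (`….stub_assembly`, p96745) — all three imported below, so `sorry` now occurs ONLY in the three
cores `stub_LW4`, `stub_deepSmallFullSize`, `stub_allPowerRich`.  Original v1 header follows.

Lead `prover-line-stmt-ABC-14938-0` (2026-08-16, cycle 1), from ideator 1's first-lemma sheet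
`Cruxes/DepthCountedABC/SketchIdeator1.lean` (cards `depth-grouped-four-logarithms`, `signature-routing`).

THE CRUX. `DepthCountedABC`: for every `K` and `ε > 0` one constant `C(K, ε)` serves abc on the cell
`ω₅(abc) := #{p : p⁵ ∣ abc} ≤ K`:  `c < C · rad(abc)^(1+ε)`.

THE LINE (the T/P cut).  Order a triple as `a ≤ b < c`.  A member `m` is *radical-like at level `δ`* when
`m ≤ rad(m)^(1+δ) · c^δ` and *power-rich* otherwise.
* a radical-like LARGE member (`b` or `c`) gives abc on the nose (`c ≤ 2b`), elementary;
* a radical-like SMALL member is the range of card 1: the small member is charged AT FULL SIZE and the two large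
  members through their radicals — at `K = 0` this is LITERALLY Lang–Waldschmidt for ONE linear form in FOUR
  logarithms with coefficients `(1,2,3,4)` (`LW4`, the card's C⁺) through the dictionary
  `LW4 → S4SmallMemberABC` (`|log(c/b)| ≤ a/b`, optimal level-4 lifts, `∏ zᵢ = S₄(c)`), and on the deep cells
  `1 ≤ ω₅ ≤ K` it is the `n = 4 + K` face (each deep prime of `bc` is one more logarithm);
* three power-rich members is card 2's residual (cores S/E/H: unbalanced spherical, Euclidean CM twists,
  the hyperbolic trio `(3,3,4), (3,4,4), (4,4,4)`), kept as ONE typed statement `AllPowerRich`.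

STUBS (registered, statements fully unfolded so that helper files can state them verbatim; `sorry` occurs ONLY in
`stub_*`):
* `stub_LW4`               [CORE T₀, OPEN — card 1's C⁺ verbatim]  `LW4`.
* `stub_dictionary`        [provable now, M]  `LW4 → S4SmallMemberABC`.
* `stub_base`              [provable now, S/M]  `S4SmallMemberABC → SmallFullSizeFiveFree` (`S₄ = rad` on 5-free numbers).
* `stub_deepSmallFullSize` [CORE T_K, OPEN — the `n = 4+K` face]  `SmallFullSizeDeep`.
* `stub_allPowerRich`      [CORE P, OPEN — card 2's residual]  `AllPowerRich`.
* `stub_assembly`          [provable now, M — real-exponent bookkeeping]  T ∧ P on every cell ⟹ the crux.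
`DepthCountedABC_of` composes them and concludes the crux BY NAME.

HONEST LABEL. The item is graded open-problem (K = 0 is abc for 5-free triples, quality 1.292 at (1, 2⁴5, 3⁴)).
Every stub is implied by ABC (`LW4` via `ABC → S4SmallMemberABC → LW4`, certificates landed separately with
`--supports`), and the two arithmetic cores are implied by the crux itself; so no stub is refutable short of `¬ABC`,
and the cores are not claimed to have a mechanism.  The line is a MAP: it lands the dictionary and the glue and
isolates the residual as three sharply typed statements.

Disproof.lean used (v3, `Cruxes/DepthCountedABC/Disproof.lean` v4 + `LineAudit-Sketch.md`): §A no kill short of `¬ABC`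
(`ABC → crux`, every open stub `⟸ ABC`); §B coprimality and `a+b=c` load-bearing, `0 < ε` load-bearing
(`cellZero_unbounded`), positivity cosmetic; §C cell-0 floor `C(0,ε)·30^(1+ε) ≥ 81`; §E `ε = 0` on a cell forces
infinitely many depth-5 Wieferich primes; §F `stub_LW4` needs `Λ ≠ 0` (kept).  No `-- Targets` entry kills a v3 stub:
the four stratum stubs are theorems of the tree's Ridout / Mahler results, and the cores are unchanged.
-/

set_option linter.dupNamespace false

namespace Summit.ABC.ABC.Cruxes.DepthCountedABC.Sketch

open scoped BigOperators
open Literature.NumberTheory.DiophantineGeometry (IsABCTriple rad)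
open UniqueFactorizationMonoid (radical)

/-! ## Vocabulary (named statements; the registered stubs below restate them fully unfolded) -/

/-- The 5-depth count `ω₅(n) = #{p prime : p⁵ ∣ n}` — verbatim the filter/card of the crux. -/
def omega5 (n : ℕ) : ℕ := (n.primeFactors.filter (fun p => 5 ≤ n.factorization p)).card

/-- Level-4 radical `S₄(n) = ∏ p^⌈v_p(n)/4⌉` (the route's `rad₄`; `= rad n` on 5-free `n`). -/
noncomputable def S4 (n : ℕ) : ℕ :=
  ∏ p ∈ n.primeFactors, p ^ ((n.factorization p + 3) / 4)

/-- The four-logarithm form `Λ₄(x) = Σ_{j=1}^{4} j · log x_j` on positive rationals (card 1). -/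
noncomputable def fourLog (x : Fin 4 → ℚ) : ℝ :=
  ∑ j : Fin 4, ((j.val : ℝ) + 1) * Real.log ((x j : ℚ) : ℝ)

/-- Multiplicative (product) height `∏_j num(x_j) · den(x_j)` (card 1). -/
def prodHeight (x : Fin 4 → ℚ) : ℕ :=
  ∏ j : Fin 4, (x j).num.natAbs * (x j).den

/-- **LW4** (card 1's C⁺, verbatim from the Sketch): the Lang–Waldschmidt / sum-of-heights lower bound for the
SINGLE linear form `Λ₄` in four logarithms of positive rationals with the fixed coefficient vector `(1,2,3,4)`,
archimedean place, multiplicative heights. -/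
def LW4 : Prop :=
  ∀ ε : ℝ, 0 < ε → ∃ C : ℝ, 0 < C ∧ ∀ x : Fin 4 → ℚ, (∀ j, 0 < x j) → fourLog x ≠ 0 →
    C⁻¹ * ((prodHeight x : ℕ) : ℝ) ^ (-(1 + ε)) ≤ |fourLog x|

/-- **S4SmallMemberABC** (verbatim from the Sketch): abc with the small member `a` counted at full size and the two
large members through their level-4 radicals `S₄`. -/
def S4SmallMemberABC : Prop :=
  ∀ ε : ℝ, 0 < ε → ∃ C : ℝ, 0 < C ∧ ∀ a b c : ℕ, IsABCTriple a b c →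
    (c : ℝ) ≤ C * (a : ℝ) * ((S4 b * S4 c : ℕ) : ℝ) ^ (1 + ε)

/-- **T-statement on the 5-free cell** `ω₅(abc) = 0`: the member `a` at full size, `b, c` through `rad(bc)`:
`c < C · (a · rad(bc))^(1+δ)`.  (Quantified over all orderings; trivial when `a` is the larger summand.) -/
def SmallFullSizeFiveFree : Prop :=
  ∀ δ : ℝ, 0 < δ → ∃ C : ℝ, 0 < C ∧ ∀ a b c : ℕ, IsABCTriple a b c → omega5 (a * b * c) = 0 →
    (c : ℝ) < C * ((a : ℝ) * ((radical (b * c) : ℕ) : ℝ)) ^ (1 + δ)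

/-- **T-statement on the deep cells** `1 ≤ ω₅(abc) ≤ K` (card 1's `n = 4 + K` face). -/
def SmallFullSizeDeep : Prop :=
  ∀ K : ℕ, ∀ δ : ℝ, 0 < δ → ∃ C : ℝ, 0 < C ∧ ∀ a b c : ℕ, IsABCTriple a b c →
    1 ≤ omega5 (a * b * c) → omega5 (a * b * c) ≤ K →
      (c : ℝ) < C * ((a : ℝ) * ((radical (b * c) : ℕ) : ℝ)) ^ (1 + δ)

/-- **P-statement** (card 2's residual, all depths): abc with exponent `1+δ` on the cell `ω₅ ≤ K` for the triples all
three of whose members are power-rich at level `δ` (`rad(m)^(1+δ)·c^δ < m`). -/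
def AllPowerRich : Prop :=
  ∀ K : ℕ, ∀ δ : ℝ, 0 < δ → ∃ C : ℝ, 0 < C ∧ ∀ a b c : ℕ, IsABCTriple a b c → omega5 (a * b * c) ≤ K →
    ((radical a : ℕ) : ℝ) ^ (1 + δ) * (c : ℝ) ^ δ < (a : ℝ) →
    ((radical b : ℕ) : ℝ) ^ (1 + δ) * (c : ℝ) ^ δ < (b : ℝ) →
    ((radical c : ℕ) : ℝ) ^ (1 + δ) * (c : ℝ) ^ δ < (c : ℝ) →
      (c : ℝ) < C * ((rad a b c : ℕ) : ℝ) ^ (1 + δ)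

/-- The assembly statement: the two T-statements and the P-statement give the crux (provable now). -/
def AssemblyStatement : Prop :=
  SmallFullSizeFiveFree → SmallFullSizeDeep → AllPowerRich →
    Summit.ABC.ABC.Theses.IneffectiveSubspace.DepthCountedABC

/-! ### v3 vocabulary — the Ridout stratum (all four statements are theorems, landed via the stubs below) -/

/-- The `y`-rough part of `n`: `∏_{p ∣ n, p > y} p^(v_p(n))` (full multiplicity at the primes above `y`). -/
def roughPart (y n : ℕ) : ℕ :=
  ∏ p ∈ n.primeFactors.filter (fun p => ¬ p ≤ y), p ^ n.factorization p

/-- **RidoutSmallMember** — the Ridout reading of the T core: the small member at full size, the two large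
members through the `y`-ROUGH PART of `bc` (not its radical): `c ≤ C(y,δ)·(a·rough_y(bc))^(1+δ)`.  A theorem
(B–G Thm 6.2.3 over `ℚ` ⟹ `DeepRegimeABC.ridoutCoreBound_holds` ⟹ this, by mass bookkeeping). -/
def RidoutSmallMember : Prop :=
  ∀ y : ℕ, ∀ δ : ℝ, 0 < δ → ∃ C : ℝ, 0 < C ∧ ∀ a b c : ℕ, IsABCTriple a b c →
    (c : ℝ) ≤ C * ((a : ℝ) * ((roughPart y (b * c) : ℕ) : ℝ)) ^ (1 + δ)

/-- **CoefficientFibre** — T on the coefficient fibres `{rad(bc) ≤ R}`, unconditionally: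
`rad(bc) ≤ R ⟹ c ≤ C(R,δ)·a^(1+δ)` (the conclusion of the conditional `stub_fibreBaker`, p108257). -/
def CoefficientFibre : Prop :=
  ∀ R : ℕ, ∀ δ : ℝ, 0 < δ → ∃ C : ℝ, 0 < C ∧ ∀ a b c : ℕ, IsABCTriple a b c →
    radical (b * c) ≤ R → (c : ℝ) ≤ C * (a : ℝ) ^ (1 + δ)

/-- **RoughPowerfulCell** — abc with exponent `1+ε` on the cell `ω₅ ≤ K` for the triples whose `y`-rough powerful
excess `Σ_{p>y, p∣abc} (v_p(abc) − 1)·log p` is at least `θ·log c` (`0 < θ`, `θ(1+ε) < ε`; `y, C` free).  By Ridout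
this is EQUIVALENT to the crux (`stub_roughPowerfulCellIff`). -/
def RoughPowerfulCell : Prop :=
  ∀ K : ℕ, ∀ ε : ℝ, 0 < ε → ∀ θ : ℝ, 0 < θ → θ * (1 + ε) < ε → ∃ y : ℕ, ∃ C : ℝ, 0 < C ∧
    ∀ a b c : ℕ, IsABCTriple a b c → omega5 (a * b * c) ≤ K →
      θ * Real.log c ≤
        ∑ p ∈ (a * b * c).primeFactors.filter (fun p => ¬ p ≤ y),
          (((a * b * c).factorization p : ℝ) - 1) * Real.log p →
      (c : ℝ) < C * ((rad a b c : ℕ) : ℝ) ^ (1 + ε)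

/-- **BoundedRadicalFibre** — the fibres `{rad(abc) ≤ R}` are bounded (Mahler 1933; the tree's
`finite_setOf_isABCTriple_primeFactors_subset_holds`), so abc holds on them with any exponent. -/
def BoundedRadicalFibre : Prop :=
  (∀ R : ℕ, ∃ B : ℕ, ∀ a b c : ℕ, IsABCTriple a b c → rad a b c ≤ R → c ≤ B) ∧
  (∀ R : ℕ, ∀ ε : ℝ, 0 < ε → ∃ C : ℝ, 0 < C ∧ ∀ a b c : ℕ, IsABCTriple a b c → rad a b c ≤ R →
    (c : ℝ) < C * ((rad a b c : ℕ) : ℝ) ^ (1 + ε))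

/-- **LWDeep K** — Lang–Waldschmidt for linear forms in at most `4 + K` logarithms of positive rationals with a
polynomial loss `B^M` in the coefficient height (card 1's `n = 4 + K` hypothesis; OPEN, abc-strength). -/
def LWDeep (K : ℕ) : Prop :=
  ∀ ε : ℝ, 0 < ε → ∃ C M : ℝ, 0 < C ∧ 0 ≤ M ∧ ∀ (s : Finset ℕ) (x : ℕ → ℚ) (u : ℕ → ℤ),
    s.card ≤ 4 + K → (∀ i ∈ s, 0 < x i) → (∑ i ∈ s, (u i : ℝ) * Real.log ((x i : ℚ) : ℝ)) ≠ 0 →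
    C⁻¹ * ((max 1 (s.sup fun i => (u i).natAbs) : ℕ) : ℝ) ^ (-M) *
        ((∏ i ∈ s, (x i).num.natAbs * (x i).den : ℕ) : ℝ) ^ (-(1 + ε)) ≤
      |∑ i ∈ s, (u i : ℝ) * Real.log ((x i : ℚ) : ℝ)|

/-- **SmallFullSizeCell K** — T on the whole cell `ω₅ ≤ K` (both `SmallFullSizeFiveFree` and `SmallFullSizeDeep`). -/
def SmallFullSizeCell (K : ℕ) : Prop :=
  ∀ δ : ℝ, 0 < δ → ∃ C : ℝ, 0 < C ∧ ∀ a b c : ℕ, IsABCTriple a b c → omega5 (a * b * c) ≤ K →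
    (c : ℝ) < C * ((a : ℝ) * ((radical (b * c) : ℕ) : ℝ)) ^ (1 + δ)

/-! ### v3·c19 vocabulary — the weakest open face of cell 0 -/

/-- **UniformQuarticThue η** — uniform binomial quartic Thue: the positive coprime solutions of
`a + u·Y⁴ = v·Z⁴` with `a·u·v ≤ Z^η` have bounded `Z` (a bound, polynomial and uniform in the coefficients,
on the SMALLEST solution of the binomial Thue equation `vZ⁴ − uY⁴ = a`; `⟸ ABC` for EVERY `η < 2` (c22 Stub 21; Stub 18 has `η < 8/5`),
FALSE for every `η > 2` (c22 Stub 18: good approximations of `2^(1/4)` give `a·u·v ≍ Z²`), OPEN unconditionally for every small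
`η > 0` — and ANY `η > 0` already yields some `δ > 0` in Stub 13). -/
def UniformQuarticThue (η : ℝ) : Prop :=
  ∃ B : ℕ, ∀ a u v Y Z : ℕ, 0 < a → 0 < u → 0 < v → 0 < Y → 0 < Z →
    a + u * Y ^ 4 = v * Z ^ 4 → Nat.Coprime (u * Y ^ 4) (v * Z ^ 4) →
    ((a * u * v : ℕ) : ℝ) ≤ (Z : ℝ) ^ η → Z ≤ B

/-- **CellZeroExponent θ** — abc with exponent `θ` on the 5-free cell: `c < C·rad(abc)^θ` whenever `ω₅(abc) = 0`
(free at `θ = 2`, `stub_calibration`; the core `stub_LW4`/`SmallFullSizeFiveFree` sits at `θ = 1 + ε`). -/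
def CellZeroExponent (θ : ℝ) : Prop :=
  ∃ C : ℝ, 0 < C ∧ ∀ a b c : ℕ, IsABCTriple a b c → omega5 (a * b * c) = 0 →
    (c : ℝ) < C * ((rad a b c : ℕ) : ℝ) ^ θ

/-- **PolyPillai N** — polynomial generalized Pillai: one `C > 0` with `s^w·v' ≤ C·(r·s·a·u·v')^N` for all primes
`r, s` and all positive coprime `a + r^v·u = s^w·v'` (`⟸ ABC` with `N = 2`; FALSE at `N = 1` — Wieferich-square families
`(1, 2ⁿ − 1, 2ⁿ)`, `p² ∣ 2ⁿ − 1`, as for `ε = 0` in abc; OPEN for every `N ≥ 2`; linear forms in logarithms give only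
`exp(O(log r·log s·log(uv')·log log c))`). -/
def PolyPillai (N : ℕ) : Prop :=
  ∃ C : ℝ, 0 < C ∧ ∀ r s a u v' v w : ℕ, r.Prime → s.Prime → 0 < a → 0 < u → 0 < v' →
    a + r ^ v * u = s ^ w * v' → Nat.Coprime (r ^ v * u) (s ^ w * v') →
    ((s ^ w * v' : ℕ) : ℝ) ≤ C * ((r * s * a * u * v' : ℕ) : ℝ) ^ N

/-- **CellTwoPolyExponent M** — abc with the polynomial exponent `M` on the cell `ω₅(abc) ≤ 2`
(no `M` is in print; cells `≤ 1` hold at `M = 4`, `stub_calibration`). -/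
def CellTwoPolyExponent (M : ℕ) : Prop :=
  ∃ C : ℝ, 0 < C ∧ ∀ a b c : ℕ, IsABCTriple a b c → omega5 (a * b * c) ≤ 2 →
    (c : ℝ) < C * ((rad a b c : ℕ) : ℝ) ^ M

/-- **UniformQuarticThueMahler η** — uniform binomial quartic Thue–Mahler (one prime power free): bounded `Z` for the
positive coprime solutions of `a + p^k·u = v·Z⁴` with `a·u·v·p ≤ Z^η`, and bounded `Y` for those of `a + u·Y⁴ = p^w·v`
with `a·u·v·p ≤ Y^η` (`p` prime).  Per coefficient class and prime this is Thue–Mahler / Schinzel–Tijdeman finiteness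
(effective by Baker, exponentially in the data); the uniform statement is OPEN for small `η` (`⟸ ABC` for `η < 3`). -/
def UniformQuarticThueMahler (η : ℝ) : Prop :=
  (∃ B : ℕ, ∀ a u v p k Z : ℕ, p.Prime → 0 < a → 0 < u → 0 < v → 0 < Z →
      a + p ^ k * u = v * Z ^ 4 → Nat.Coprime (p ^ k * u) (v * Z ^ 4) →
      ((a * u * v * p : ℕ) : ℝ) ≤ (Z : ℝ) ^ η → Z ≤ B) ∧
  (∃ B : ℕ, ∀ a u v p w Y : ℕ, p.Prime → 0 < a → 0 < u → 0 < v → 0 < Y →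
      a + u * Y ^ 4 = p ^ w * v → Nat.Coprime (u * Y ^ 4) (p ^ w * v) →
      ((a * u * v * p : ℕ) : ℝ) ≤ (Y : ℝ) ^ η → Y ≤ B)

/-- **CellOneExponent θ** — abc with exponent `θ` on the cell `ω₅(abc) ≤ 1`: `c < C·rad(abc)^θ`
(free at `θ = 4`, `stub_calibration`). -/
def CellOneExponent (θ : ℝ) : Prop :=
  ∃ C : ℝ, 0 < C ∧ ∀ a b c : ℕ, IsABCTriple a b c → omega5 (a * b * c) ≤ 1 →
    (c : ℝ) < C * ((rad a b c : ℕ) : ℝ) ^ θ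

/-! ### v3·c23 vocabulary — the little-o statements of the shallow cells (both THEOREMS, Stubs 22/23) -/

/-- **CellZeroLittleO** — `c = o(rad(abc)²)` on the 5-free cell: for every `κ > 0`, `c < κ·rad²` from some `c₀(κ)` on
(a theorem: Roth fibrewise over a finite box, Stub 22; EQUIVALENT to Thue fibrewise on the cell, Stub 25). -/
def CellZeroLittleO : Prop :=
  ∀ κ : ℝ, 0 < κ → ∃ c₀ : ℕ, ∀ a b c : ℕ, IsABCTriple a b c → omega5 (a * b * c) = 0 → c₀ ≤ c →
    (c : ℝ) < κ * ((rad a b c : ℕ) : ℝ) ^ 2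

/-- **CellOneLittleO** — `c = o(rad(abc)⁴)` on the cell `ω₅(abc) ≤ 1` (a theorem: the tree-proved Bugeaud–Evertse–Győry
S-part bound = Ridout, fibrewise over a finite box of Thue–Mahler data, Stub 23). -/
def CellOneLittleO : Prop :=
  ∀ κ : ℝ, 0 < κ → ∃ c₀ : ℕ, ∀ a b c : ℕ, IsABCTriple a b c → omega5 (a * b * c) ≤ 1 → c₀ ≤ c →
    (c : ℝ) < κ * ((rad a b c : ℕ) : ℝ) ^ 4

/-! ## Registered stubs — statements FULLY UNFOLDED (v3·c23: `sorry` lives ONLY in Stubs 1, 4, 5 — the cores; the certificate Stubs 22–29 of c23 are LANDED, p160408/p160878/p161405/p161590/p162369/p162960/p164544/p165256; the certificate Stubs 13–17 of c19 are LANDED, p148304/p148305/p148454/p149866/p150672; the certificate Stubs 18–21 of c22 are LANDED, p157260/p157144/p157002/p157829)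

Helper files under `Theorems/` restate these signatures verbatim (they cannot import this workfile). -/

/-- Stub 1 · **CORE T₀ (OPEN)** — `LW4`, card 1's C⁺ (unfolded). -/
theorem stub_LW4 : ∀ ε : ℝ, 0 < ε → ∃ C : ℝ, 0 < C ∧ ∀ x : Fin 4 → ℚ, (∀ j, 0 < x j) →
    (∑ j : Fin 4, ((j.val : ℝ) + 1) * Real.log ((x j : ℚ) : ℝ)) ≠ 0 →
    C⁻¹ * ((∏ j : Fin 4, (x j).num.natAbs * (x j).den : ℕ) : ℝ) ^ (-(1 + ε)) ≤
      |∑ j : Fin 4, ((j.val : ℝ) + 1) * Real.log ((x j : ℚ) : ℝ)| := by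
  sorry

/-- Stub 2 · **DICTIONARY (CLOSED: landed as `Summit.ABC.ABC.Theorems.DepthCountedABC.stub_dictionary`, p96764)** — `LW4 → S4SmallMemberABC` (unfolded): for an abc triple lift `b, c`
optimally to level 4 (`Summit.ABC.ABC.Theorems.TowerFourGivesDepthCounted.exists_lift`: `∏ yᵢ^(i+1) = b`,
`v_p(∏ yᵢ) = ⌈v_p(b)/4⌉`), put `x_j := z_j / y_j`; then `Λ₄(x) = log c − log b ∈ (0, a/b]` and
`∏ num·den ≤ (∏ zᵢ)(∏ yᵢ) = S₄(c)·S₄(b)`, so `LW4` at `ε` gives `b ≤ C·a·(S₄(b)S₄(c))^(1+ε)` and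
`c = a + b ≤ (C+1)·a·(…)^(1+ε)`. -/
theorem stub_dictionary :
    (∀ ε : ℝ, 0 < ε → ∃ C : ℝ, 0 < C ∧ ∀ x : Fin 4 → ℚ, (∀ j, 0 < x j) →
      (∑ j : Fin 4, ((j.val : ℝ) + 1) * Real.log ((x j : ℚ) : ℝ)) ≠ 0 →
      C⁻¹ * ((∏ j : Fin 4, (x j).num.natAbs * (x j).den : ℕ) : ℝ) ^ (-(1 + ε)) ≤
        |∑ j : Fin 4, ((j.val : ℝ) + 1) * Real.log ((x j : ℚ) : ℝ)|) →
    ∀ ε : ℝ, 0 < ε → ∃ C : ℝ, 0 < C ∧ ∀ a b c : ℕ,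
      Literature.NumberTheory.DiophantineGeometry.IsABCTriple a b c →
      (c : ℝ) ≤ C * (a : ℝ) *
        (((∏ p ∈ b.primeFactors, p ^ ((b.factorization p + 3) / 4)) *
          (∏ p ∈ c.primeFactors, p ^ ((c.factorization p + 3) / 4)) : ℕ) : ℝ) ^ (1 + ε) :=
  Summit.ABC.ABC.Theorems.DepthCountedABC.stub_dictionary

/-- Stub 3 · **BASE (CLOSED: landed as `Summit.ABC.ABC.Theorems.DepthCountedABC.stub_base`, p96440)** — `S4SmallMemberABC → SmallFullSizeFiveFree` (unfolded): on a 5-free triple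
(`ω₅(abc) = 0`) every `v_p(b), v_p(c) ≤ 4`, so `S₄(b) = rad b`, `S₄(c) = rad c`, `rad b · rad c = rad(bc)` (coprime),
and `C·a·rad(bc)^(1+δ) ≤ C·(a·rad(bc))^(1+δ) < (C+1)·(…)` since `a ≥ 1`. -/
theorem stub_base :
    (∀ ε : ℝ, 0 < ε → ∃ C : ℝ, 0 < C ∧ ∀ a b c : ℕ,
      Literature.NumberTheory.DiophantineGeometry.IsABCTriple a b c →
      (c : ℝ) ≤ C * (a : ℝ) *
        (((∏ p ∈ b.primeFactors, p ^ ((b.factorization p + 3) / 4)) *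
          (∏ p ∈ c.primeFactors, p ^ ((c.factorization p + 3) / 4)) : ℕ) : ℝ) ^ (1 + ε)) →
    ∀ δ : ℝ, 0 < δ → ∃ C : ℝ, 0 < C ∧ ∀ a b c : ℕ,
      Literature.NumberTheory.DiophantineGeometry.IsABCTriple a b c →
      ((a * b * c).primeFactors.filter (fun p => 5 ≤ (a * b * c).factorization p)).card = 0 →
      (c : ℝ) < C * ((a : ℝ) * ((UniqueFactorizationMonoid.radical (b * c) : ℕ) : ℝ)) ^ (1 + δ) :=
  Summit.ABC.ABC.Theorems.DepthCountedABC.stub_base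

/-- Stub 4 · **CORE T_K (OPEN)** — the small member at full size on the deep cells `1 ≤ ω₅(abc) ≤ K` (unfolded;
card 1's `n = 4 + K` face: `log(c/b) = Σ_j j·log(C_j/B_j) + Σ_{p deep, p ∣ bc} (v_p(c) − v_p(b))·log p`).
LOCALISED (v3·c15, Stub 11): equivalent to its restriction to `X_y(abc) ≥ θ log c` (rough powerful excess in
primes `> y`); implied by `LWDeep K` (Stub 10, landed) and by ABC. -/
theorem stub_deepSmallFullSize : ∀ K : ℕ, ∀ δ : ℝ, 0 < δ → ∃ C : ℝ, 0 < C ∧ ∀ a b c : ℕ,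
    Literature.NumberTheory.DiophantineGeometry.IsABCTriple a b c →
    1 ≤ ((a * b * c).primeFactors.filter (fun p => 5 ≤ (a * b * c).factorization p)).card →
    ((a * b * c).primeFactors.filter (fun p => 5 ≤ (a * b * c).factorization p)).card ≤ K →
      (c : ℝ) < C * ((a : ℝ) * ((UniqueFactorizationMonoid.radical (b * c) : ℕ) : ℝ)) ^ (1 + δ) := by
  sorry

/-- Stub 5 · **CORE P (OPEN)** — `AllPowerRich`, card 2's residual (unfolded).  LOCALISED (v3·c15, Stub 12):
equivalent to its restriction to the triples with `X_y(abc) ≥ θ log c`. -/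
theorem stub_allPowerRich : ∀ K : ℕ, ∀ δ : ℝ, 0 < δ → ∃ C : ℝ, 0 < C ∧ ∀ a b c : ℕ,
    Literature.NumberTheory.DiophantineGeometry.IsABCTriple a b c →
    ((a * b * c).primeFactors.filter (fun p => 5 ≤ (a * b * c).factorization p)).card ≤ K →
    ((UniqueFactorizationMonoid.radical a : ℕ) : ℝ) ^ (1 + δ) * (c : ℝ) ^ δ < (a : ℝ) →
    ((UniqueFactorizationMonoid.radical b : ℕ) : ℝ) ^ (1 + δ) * (c : ℝ) ^ δ < (b : ℝ) →
    ((UniqueFactorizationMonoid.radical c : ℕ) : ℝ) ^ (1 + δ) * (c : ℝ) ^ δ < (c : ℝ) →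
      (c : ℝ) < C * ((Literature.NumberTheory.DiophantineGeometry.rad a b c : ℕ) : ℝ) ^ (1 + δ) := by
  sorry

/-- Stub 6 · **ASSEMBLY (CLOSED: landed as `Summit.ABC.ABC.Theorems.DepthCountedABC.stub_assembly`, p96745)** — `AssemblyStatement` (unfolded): given `K, ε` put `ε' = min ε 1`,
`δ = ε'/10`; for a triple of the cell ordered `a ≤ b`: `c` radical-like ⟹ `c ≤ rad(c)^((1+δ)/(1−δ))`;
`b` radical-like ⟹ `c ≤ 2b ≤ 2·rad(b)^(1+δ)c^δ`; `a` radical-like ⟹ T gives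
`c < C(a·rad(bc))^(1+δ) ≤ C·c^(δ(1+δ))·rad(abc)^((1+δ)²)` (`rad a · rad(bc) = rad(abc)` by coprimality); else P.
Each case ends with `c < C'·rad(abc)^(1+ε')`, and `rad^(1+ε') ≤ rad^(1+ε)`; the other ordering by the symmetry
`(a,b) ↦ (b,a)` of all three statements. -/
theorem stub_assembly :
    (∀ δ : ℝ, 0 < δ → ∃ C : ℝ, 0 < C ∧ ∀ a b c : ℕ,
      Literature.NumberTheory.DiophantineGeometry.IsABCTriple a b c →
      ((a * b * c).primeFactors.filter (fun p => 5 ≤ (a * b * c).factorization p)).card = 0 →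
      (c : ℝ) < C * ((a : ℝ) * ((UniqueFactorizationMonoid.radical (b * c) : ℕ) : ℝ)) ^ (1 + δ)) →
    (∀ K : ℕ, ∀ δ : ℝ, 0 < δ → ∃ C : ℝ, 0 < C ∧ ∀ a b c : ℕ,
      Literature.NumberTheory.DiophantineGeometry.IsABCTriple a b c →
      1 ≤ ((a * b * c).primeFactors.filter (fun p => 5 ≤ (a * b * c).factorization p)).card →
      ((a * b * c).primeFactors.filter (fun p => 5 ≤ (a * b * c).factorization p)).card ≤ K →
      (c : ℝ) < C * ((a : ℝ) * ((UniqueFactorizationMonoid.radical (b * c) : ℕ) : ℝ)) ^ (1 + δ)) →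
    (∀ K : ℕ, ∀ δ : ℝ, 0 < δ → ∃ C : ℝ, 0 < C ∧ ∀ a b c : ℕ,
      Literature.NumberTheory.DiophantineGeometry.IsABCTriple a b c →
      ((a * b * c).primeFactors.filter (fun p => 5 ≤ (a * b * c).factorization p)).card ≤ K →
      ((UniqueFactorizationMonoid.radical a : ℕ) : ℝ) ^ (1 + δ) * (c : ℝ) ^ δ < (a : ℝ) →
      ((UniqueFactorizationMonoid.radical b : ℕ) : ℝ) ^ (1 + δ) * (c : ℝ) ^ δ < (b : ℝ) →
      ((UniqueFactorizationMonoid.radical c : ℕ) : ℝ) ^ (1 + δ) * (c : ℝ) ^ δ < (c : ℝ) →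
      (c : ℝ) < C * ((Literature.NumberTheory.DiophantineGeometry.rad a b c : ℕ) : ℝ) ^ (1 + δ)) →
    Summit.ABC.ABC.Theses.IneffectiveSubspace.DepthCountedABC :=
  Summit.ABC.ABC.Theorems.DepthCountedABC.stub_assembly

/-! ## v3 stratum stubs — the Ridout stratum (ALL FOUR CLOSED as of cycle 15: p141112, p140411, p140359, p141159) -/

/-- Stub 7 · **RIDOUT SMALL MEMBER (CLOSED: landed as `Summit.ABC.ABC.Theorems.DepthCountedABC.stub_ridoutSmallMember`, p141112)** — `RidoutSmallMember ∧ CoefficientFibre` (unfolded).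
From `Summit.ABC.ABC.Theorems.DeepRegimeABC.ridoutCoreBound_holds y δ'` (`δ' = δ/(1+δ)`): a CORED triple
(`Σ_{p≤y, p∣abc} v_p(abc) log p + log(c/min(a,b)) ≥ (2+δ') log c`) has `c ≤ B`; a coreless one has rough mass
`R_y > (1−δ') log c − log 2` (`DeepRegimeABC.roughMass_gt_of_coreMass_lt`) and `R_y ≤ log a + log rough_y(bc)`
(`ridoutSmallMember_roughMass_le`), whence `c^(1−δ') < 2a·rough_y(bc)`, `c < (2a·rough_y(bc))^(1+δ)`;
`C = max B 1 · 2^(1+δ)`.  The coefficient fibre: `rad(bc) ≤ R ⟹ rough_R(bc) = 1`. -/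
theorem stub_ridoutSmallMember :
    (∀ y : ℕ, ∀ δ : ℝ, 0 < δ → ∃ C : ℝ, 0 < C ∧ ∀ a b c : ℕ,
      Literature.NumberTheory.DiophantineGeometry.IsABCTriple a b c →
      (c : ℝ) ≤ C * ((a : ℝ) *
        ((∏ p ∈ (b * c).primeFactors.filter (fun p => ¬ p ≤ y), p ^ (b * c).factorization p : ℕ) : ℝ)) ^
          (1 + δ)) ∧
    (∀ R : ℕ, ∀ δ : ℝ, 0 < δ → ∃ C : ℝ, 0 < C ∧ ∀ a b c : ℕ,
      Literature.NumberTheory.DiophantineGeometry.IsABCTriple a b c →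
      UniqueFactorizationMonoid.radical (b * c) ≤ R → (c : ℝ) ≤ C * (a : ℝ) ^ (1 + δ)) :=
  Summit.ABC.ABC.Theorems.DepthCountedABC.stub_ridoutSmallMember

/-- Stub 8 · **RIDOUT NORMAL FORM OF THE CRUX (CLOSED: landed as `Summit.ABC.ABC.Theorems.DepthCountedABC.stub_roughPowerfulCellIff`, p140411)** — `DepthCountedABC ↔ RoughPowerfulCell`
(unfolded).  `→`: drop the excess hypothesis.  `←`: given `K, ε` take `θ = ε/(2(1+ε))`, `δ = ε/(4(1+ε))` and the
hypothesis' `y, C`; CORED triples of the cell are bounded by `DeepRegimeABC.ridoutCoreBound_holds y δ`; a CORELESS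
violator of `c < C'·rad^(1+ε)` (`C' ≥ 1`) has rough mass `> (1−δ) log c − log 2`
(`DeepRegimeABC.roughMass_gt_of_coreMass_lt`) and `Σ_{p>y} log p ≤ log rad ≤ log c/(1+ε)`
(`DeepRegimeABC.sum_rough_log_le_log_rad`), so its excess is `≥ θ log c` once `c ≥ 2^(1/δ)` and the hypothesis
bounds it — verbatim the landed `DeepRegimeABC.stub_roughReduction` / `deepRegimeABC_of_roughPowerfulTail` with
the tail condition `K ≤ ω₅` replaced by the cell condition `ω₅ ≤ K`. -/
theorem stub_roughPowerfulCellIff :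
    Summit.ABC.ABC.Theses.IneffectiveSubspace.DepthCountedABC ↔
    (∀ K : ℕ, ∀ ε : ℝ, 0 < ε → ∀ θ : ℝ, 0 < θ → θ * (1 + ε) < ε → ∃ y : ℕ, ∃ C : ℝ, 0 < C ∧
      ∀ a b c : ℕ, Literature.NumberTheory.DiophantineGeometry.IsABCTriple a b c →
        ((a * b * c).primeFactors.filter (fun p => 5 ≤ (a * b * c).factorization p)).card ≤ K →
        θ * Real.log c ≤
          ∑ p ∈ (a * b * c).primeFactors.filter (fun p => ¬ p ≤ y),
            (((a * b * c).factorization p : ℝ) - 1) * Real.log p →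
        (c : ℝ) < C * ((Literature.NumberTheory.DiophantineGeometry.rad a b c : ℕ) : ℝ) ^ (1 + ε)) :=
  Summit.ABC.ABC.Theorems.DepthCountedABC.stub_roughPowerfulCellIff

/-- Stub 9 · **BOUNDED-RADICAL FIBRES (CLOSED: landed as `Summit.ABC.ABC.Theorems.DepthCountedABC.stub_boundedRadicalCell`, p140359)** — `BoundedRadicalFibre` (unfolded): `rad(abc) ≤ R`
puts every prime factor of `abc` in `{0,…,R}`, so the triple lies in the finite set of
`Literature.NumberTheory.DiophantineGeometry.finite_setOf_isABCTriple_primeFactors_subset_holds (Finset.range (R+1))`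
(Mahler 1933, tree-proved), whence a bound `B(R)` on `c`; and then `c < (B+1)·rad^(1+ε)` as `rad ≥ 1`. -/
theorem stub_boundedRadicalCell :
    (∀ R : ℕ, ∃ B : ℕ, ∀ a b c : ℕ, Literature.NumberTheory.DiophantineGeometry.IsABCTriple a b c →
      Literature.NumberTheory.DiophantineGeometry.rad a b c ≤ R → c ≤ B) ∧
    (∀ R : ℕ, ∀ ε : ℝ, 0 < ε → ∃ C : ℝ, 0 < C ∧ ∀ a b c : ℕ,
      Literature.NumberTheory.DiophantineGeometry.IsABCTriple a b c →
      Literature.NumberTheory.DiophantineGeometry.rad a b c ≤ R →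
      (c : ℝ) < C * ((Literature.NumberTheory.DiophantineGeometry.rad a b c : ℕ) : ℝ) ^ (1 + ε)) :=
  Summit.ABC.ABC.Theorems.DepthCountedABC.stub_boundedRadicalCell

/-- Stub 10 · **LW-DEEP DICTIONARY (CLOSED: landed as `Summit.ABC.ABC.Theorems.DepthCountedABC.stub_lwDeepDictionary`, p141159)** — `LWDeep K → SmallFullSizeCell K`
(unfolded): by `Summit.ABC.ABC.Theorems.DepthCountedABC.stub_lwDeepDictionaryLemmas` (p103330) an abc triple has a
depth-grouped form `Σ_{i∈s} u_i log x_i = log c − log b` with `#s ≤ 4 + ω₅(abc)`, `x_i > 0`, height product EXACTLY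
`rad(bc)` and `|u_i| ≤ 4 + log₂ c`; `log c − log b ∈ (0, a/b]`, so `LWDeep K` at `ε = δ/(2+δ)` gives
`b ≤ C·a·B^M·rad(bc)^(1+ε)` with `B ≤ 4 + log₂ c ≤ 3·(2 log c/log 2)`; the factor `B^M` is absorbed into `c^η`,
`η = δ/(2+δ)` (`fibreBaker_logpow_le`, p108257; `lwDeepDict_coeff_rpow_le`), and `c = a + b ≤ M₁·a·H^(1+ε)·c^η`
extracts to `c < C'·(a·rad(bc))^(1+δ)` (`lwDeepDict_absorb`). -/
theorem stub_lwDeepDictionary : ∀ K : ℕ,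
    (∀ ε : ℝ, 0 < ε → ∃ C M : ℝ, 0 < C ∧ 0 ≤ M ∧ ∀ (s : Finset ℕ) (x : ℕ → ℚ) (u : ℕ → ℤ),
      s.card ≤ 4 + K → (∀ i ∈ s, 0 < x i) → (∑ i ∈ s, (u i : ℝ) * Real.log ((x i : ℚ) : ℝ)) ≠ 0 →
      C⁻¹ * ((max 1 (s.sup fun i => (u i).natAbs) : ℕ) : ℝ) ^ (-M) *
          ((∏ i ∈ s, (x i).num.natAbs * (x i).den : ℕ) : ℝ) ^ (-(1 + ε)) ≤
        |∑ i ∈ s, (u i : ℝ) * Real.log ((x i : ℚ) : ℝ)|) →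
    ∀ δ : ℝ, 0 < δ → ∃ C : ℝ, 0 < C ∧ ∀ a b c : ℕ,
      Literature.NumberTheory.DiophantineGeometry.IsABCTriple a b c →
      ((a * b * c).primeFactors.filter (fun p => 5 ≤ (a * b * c).factorization p)).card ≤ K →
      (c : ℝ) < C * ((a : ℝ) * ((UniqueFactorizationMonoid.radical (b * c) : ℕ) : ℝ)) ^ (1 + δ) :=
  Summit.ABC.ABC.Theorems.DepthCountedABC.stub_lwDeepDictionary


/-! ## v3·c15 certificates — the Ridout LOCALISATION of the cores (both CLOSED; registered certificate stubs)

With the Ridout stratum landed, each open core is EQUIVALENT to its restriction to the triples whose `y`-rough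
powerful excess `X_y(abc) := Σ_{p>y, p∣abc}(v_p(abc) − 1)·log p` is `≥ θ·log c` (`0 < θ`, `θ(1+δ) < δ`; `y, C`
free): the open content of line `Sketch` sits entirely on triples carrying a powerful part `≥ c^θ` made of primes
`> y` — in cell 0 these are primes `p > y` with `v_p(abc) ∈ {2,3,4}` (quartic/cubic/square twists by LARGE primes);
every configuration whose powerfulness comes from small primes or is `o(log c)` is settled by Ridout.  The general
statements (`ridoutLocal_smallFullSize_iff P`, `ridoutLocal_abc_iff P`, arbitrary side condition `P`) are landed in
`Theorems/IneffectiveSubspaceDepthCountedABCRidoutLocalisation{,Abc}.lean` (p142136, p141850). -/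

/-- Stub 11 · **LOCALISED DEEP T CORE (CLOSED: landed as
`Summit.ABC.ABC.Theorems.DepthCountedABC.stub_ridoutLocalDeepSmallFullSizeIff`, p142136)** — the core
`stub_deepSmallFullSize` is equivalent to T on the deep cells restricted to `X_y(abc) ≥ θ log c`; the 5-free T core
localises identically (`ridoutLocal_smallFullSizeFiveFree_iff`, same file). -/
theorem stub_ridoutLocalDeepSmallFullSizeIff :
    (∀ K : ℕ, ∀ δ : ℝ, 0 < δ → ∃ C : ℝ, 0 < C ∧ ∀ a b c : ℕ,
      Literature.NumberTheory.DiophantineGeometry.IsABCTriple a b c →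
      1 ≤ ((a * b * c).primeFactors.filter (fun p => 5 ≤ (a * b * c).factorization p)).card →
      ((a * b * c).primeFactors.filter (fun p => 5 ≤ (a * b * c).factorization p)).card ≤ K →
      (c : ℝ) < C * ((a : ℝ) * ((UniqueFactorizationMonoid.radical (b * c) : ℕ) : ℝ)) ^ (1 + δ)) ↔
    (∀ K : ℕ, ∀ δ : ℝ, 0 < δ → ∀ θ : ℝ, 0 < θ → θ * (1 + δ) < δ → ∃ y : ℕ, ∃ C : ℝ, 0 < C ∧
      ∀ a b c : ℕ, Literature.NumberTheory.DiophantineGeometry.IsABCTriple a b c →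
      1 ≤ ((a * b * c).primeFactors.filter (fun p => 5 ≤ (a * b * c).factorization p)).card →
      ((a * b * c).primeFactors.filter (fun p => 5 ≤ (a * b * c).factorization p)).card ≤ K →
        θ * Real.log c ≤
          ∑ p ∈ (a * b * c).primeFactors.filter (fun p => ¬ p ≤ y),
            (((a * b * c).factorization p : ℝ) - 1) * Real.log p →
        (c : ℝ) < C * ((a : ℝ) * ((UniqueFactorizationMonoid.radical (b * c) : ℕ) : ℝ)) ^ (1 + δ)) :=
  Summit.ABC.ABC.Theorems.DepthCountedABC.stub_ridoutLocalDeepSmallFullSizeIff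

/-- Stub 12 · **LOCALISED P CORE (CLOSED: landed as
`Summit.ABC.ABC.Theorems.DepthCountedABC.stub_ridoutLocalAllPowerRichIff`, p141850)** — the core `stub_allPowerRich`
is equivalent to abc with exponent `1+δ` on the all-power-rich triples of the cell restricted to `X_y(abc) ≥ θ log c`
(all-power-rich triples built from small primes, e.g. `11² + 3²5⁶7³ = 2²¹·23` at `δ = 1/10`, have `X_y(abc) = 0` once
`y ≥ 23` and are settled by the Ridout branch). -/
theorem stub_ridoutLocalAllPowerRichIff :
    (∀ K : ℕ, ∀ δ : ℝ, 0 < δ → ∃ C : ℝ, 0 < C ∧ ∀ a b c : ℕ,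
      Literature.NumberTheory.DiophantineGeometry.IsABCTriple a b c →
      ((a * b * c).primeFactors.filter (fun p => 5 ≤ (a * b * c).factorization p)).card ≤ K →
      ((UniqueFactorizationMonoid.radical a : ℕ) : ℝ) ^ (1 + δ) * (c : ℝ) ^ δ < (a : ℝ) →
      ((UniqueFactorizationMonoid.radical b : ℕ) : ℝ) ^ (1 + δ) * (c : ℝ) ^ δ < (b : ℝ) →
      ((UniqueFactorizationMonoid.radical c : ℕ) : ℝ) ^ (1 + δ) * (c : ℝ) ^ δ < (c : ℝ) →
      (c : ℝ) < C * ((Literature.NumberTheory.DiophantineGeometry.rad a b c : ℕ) : ℝ) ^ (1 + δ)) ↔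
    (∀ K : ℕ, ∀ δ : ℝ, 0 < δ → ∀ θ : ℝ, 0 < θ → θ * (1 + δ) < δ → ∃ y : ℕ, ∃ C : ℝ, 0 < C ∧
      ∀ a b c : ℕ, Literature.NumberTheory.DiophantineGeometry.IsABCTriple a b c →
      ((a * b * c).primeFactors.filter (fun p => 5 ≤ (a * b * c).factorization p)).card ≤ K →
      ((UniqueFactorizationMonoid.radical a : ℕ) : ℝ) ^ (1 + δ) * (c : ℝ) ^ δ < (a : ℝ) →
      ((UniqueFactorizationMonoid.radical b : ℕ) : ℝ) ^ (1 + δ) * (c : ℝ) ^ δ < (b : ℝ) →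
      ((UniqueFactorizationMonoid.radical c : ℕ) : ℝ) ^ (1 + δ) * (c : ℝ) ^ δ < (c : ℝ) →
        θ * Real.log c ≤
          ∑ p ∈ (a * b * c).primeFactors.filter (fun p => ¬ p ≤ y),
            (((a * b * c).factorization p : ℝ) - 1) * Real.log p →
        (c : ℝ) < C * ((Literature.NumberTheory.DiophantineGeometry.rad a b c : ℕ) : ℝ) ^ (1 + δ)) :=
  Summit.ABC.ABC.Theorems.DepthCountedABC.stub_ridoutLocalAllPowerRichIff

/-- Stub 13 · **WEAKEST OPEN FACE OF CELL 0 (certificate, v3·c19; CLOSED: landed as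
`Summit.ABC.ABC.Theorems.DepthCountedABC.stub_cellZeroOfUniformQuarticThue`, p148304)** —
`UniformQuarticThue η → ∃ δ > 0, CellZeroExponent (2 − δ)` (unfolded; `δ = min(η,1)/64` works): the FIRST improvement of
the free exponent 2 on the 5-free cell follows from (and, on the squarefree-coprime locus, implies) uniform binomial
quartic Thue.  Mechanism: `c ≥ rad^(2−δ)` forces `a·c² ≤ 2rad⁴` and defects `E(b)E(c)·c² ≤ 2rad⁴` (`E(n)·n = rad(n)⁴`,
non-quartic part `≤ E(n)³`), so `b = uY⁴`, `c = vZ⁴` with `a·u·v·c⁸ ≤ 16rad¹⁶`, `c⁷ ≤ 8rad¹²Z⁴`. -/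
theorem stub_cellZeroOfUniformQuarticThue : ∀ η : ℝ, 0 < η →
    (∃ B : ℕ, ∀ a u v Y Z : ℕ, 0 < a → 0 < u → 0 < v → 0 < Y → 0 < Z →
        a + u * Y ^ 4 = v * Z ^ 4 → Nat.Coprime (u * Y ^ 4) (v * Z ^ 4) →
        ((a * u * v : ℕ) : ℝ) ≤ (Z : ℝ) ^ η → Z ≤ B) →
    ∃ δ : ℝ, 0 < δ ∧ ∃ C : ℝ, 0 < C ∧ ∀ a b c : ℕ,
      Literature.NumberTheory.DiophantineGeometry.IsABCTriple a b c →
      ((a * b * c).primeFactors.filter (fun p => 5 ≤ (a * b * c).factorization p)).card = 0 →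
      (c : ℝ) < C * ((Literature.NumberTheory.DiophantineGeometry.rad a b c : ℕ) : ℝ) ^ (2 - δ) :=
  Summit.ABC.ABC.Theorems.DepthCountedABC.stub_cellZeroOfUniformQuarticThue

/-- Stub 14 · **WEAKEST OPEN FACE OF CELL 0, CONVERSE (certificate, v3·c19; CLOSED: landed as
`Summit.ABC.ABC.Theorems.DepthCountedABC.stub_uniformQuarticThueOfCellZero`, p148305)** —
`CellZeroExponent (2 − δ) → UniformQuarticThue η` for every `η < 4δ/5` ON THE 5-FREE LOCUS (the solutions whose triple
`(a, uY⁴, vZ⁴)` lies in cell 0: `Y, Z` squarefree, `gcd(u,Y) = gcd(v,Z) = 1`, `a, u, v` 5-free), unfolded.  With Stub 13: the first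
`δ` below the free exponent 2 on cell 0 is EXACTLY a uniform bound on the smallest solution of `vZ⁴ − uY⁴ = a`. -/
theorem stub_uniformQuarticThueOfCellZero : ∀ δ : ℝ, 0 < δ →
    (∃ C : ℝ, 0 < C ∧ ∀ a b c : ℕ, Literature.NumberTheory.DiophantineGeometry.IsABCTriple a b c →
      ((a * b * c).primeFactors.filter (fun p => 5 ≤ (a * b * c).factorization p)).card = 0 →
      (c : ℝ) < C * ((Literature.NumberTheory.DiophantineGeometry.rad a b c : ℕ) : ℝ) ^ (2 - δ)) →
    ∀ η : ℝ, 0 < η → 5 * η < 4 * δ →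
    ∃ B : ℕ, ∀ a u v Y Z : ℕ, 0 < a → 0 < u → 0 < v → 0 < Y → 0 < Z →
      a + u * Y ^ 4 = v * Z ^ 4 → Nat.Coprime (u * Y ^ 4) (v * Z ^ 4) →
      ((a * (u * Y ^ 4) * (v * Z ^ 4)).primeFactors.filter
          (fun p => 5 ≤ (a * (u * Y ^ 4) * (v * Z ^ 4)).factorization p)).card = 0 →
      ((a * u * v : ℕ) : ℝ) ≤ (Z : ℝ) ^ η → Z ≤ B :=
  Summit.ABC.ABC.Theorems.DepthCountedABC.stub_uniformQuarticThueOfCellZero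

/-- Stub 15 · **POLYNOMIAL FACE OF CELL 2 (certificate, v3·c19; CLOSED: landed as
`Summit.ABC.ABC.Theorems.DepthCountedABC.stub_cellTwoOfPolyPillai`, p148454)** — `PolyPillai N → CellTwoPolyExponent (14N + 8)`
(unfolded): every placement of the two deep primes is elementary (`c ≤ 2rad⁸`) except deep `r ∣ b`, `s ∣ c` with `a² < c`,
which is a generalized Pillai configuration `a + r^v·u = s^w·v'` with `r·s·a·u·v' ≤ rad¹⁴`; the converse (a polynomial
exponent on the cell gives polynomial generalized Pillai on the configurations in the cell) is immediate from
`rad ≤ r·s·a·u·v'`.  So the distance of cell 2 from ANY polynomial exponent is exactly polynomial generalized Pillai. -/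
theorem stub_cellTwoOfPolyPillai : ∀ N : ℕ,
    (∃ C : ℝ, 0 < C ∧ ∀ r s a u v' v w : ℕ, r.Prime → s.Prime → 0 < a → 0 < u → 0 < v' →
        a + r ^ v * u = s ^ w * v' → Nat.Coprime (r ^ v * u) (s ^ w * v') →
        ((s ^ w * v' : ℕ) : ℝ) ≤ C * ((r * s * a * u * v' : ℕ) : ℝ) ^ N) →
    ∃ C : ℝ, 0 < C ∧ ∀ a b c : ℕ, Literature.NumberTheory.DiophantineGeometry.IsABCTriple a b c →
      ((a * b * c).primeFactors.filter (fun p => 5 ≤ (a * b * c).factorization p)).card ≤ 2 →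
      (c : ℝ) < C * ((Literature.NumberTheory.DiophantineGeometry.rad a b c : ℕ) : ℝ) ^ (14 * N + 8) :=
  Summit.ABC.ABC.Theorems.DepthCountedABC.stub_cellTwoOfPolyPillai

/-- Stub 16 · **CASE ANALYSIS OF CELL 1 (certificate / arithmetic input of Stub 17, v3·c19; CLOSED: landed as
`Summit.ABC.ABC.Theorems.DepthCountedABC.stub_cellOneCases`, p149866)** — for a
triple of the cell `ω₅ ≤ 1` ordered `a ≤ b`: either `c < 2rad²` (deep prime meets neither `b` nor `c`), or the deep prime
sits in `b` (Thue–Mahler configuration `a + p^k·u = v·Z⁴`, `a·u·v·p·c⁴ ≤ rad¹⁶`, `c⁴ ≤ rad¹²Z⁴`), or in `c`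
(`a + u·Y⁴ = p^w·v`, `c ≤ 2b`, `a·u·v·p·b⁴ ≤ rad¹⁶`, `b⁴ ≤ rad¹²Y⁴`). -/
theorem stub_cellOneCases : ∀ a b c : ℕ, Literature.NumberTheory.DiophantineGeometry.IsABCTriple a b c → a ≤ b → ((a * b * c).primeFactors.filter (fun p => 5 ≤ (a * b * c).factorization p)).card ≤ 1 → (c < 2 * (Literature.NumberTheory.DiophantineGeometry.rad a b c) ^ 2 ∨ (∃ p k u v Z : ℕ, p.Prime ∧ 0 < u ∧ 0 < v ∧ 0 < Z ∧ a + p ^ k * u = v * Z ^ 4 ∧ Nat.Coprime (p ^ k * u) (v * Z ^ 4) ∧ c = v * Z ^ 4 ∧ a * u * v * p * c ^ 4 ≤ (Literature.NumberTheory.DiophantineGeometry.rad a b c) ^ 16 ∧ c ^ 4 ≤ (Literature.NumberTheory.DiophantineGeometry.rad a b c) ^ 12 * Z ^ 4) ∨ (∃ p w u v Y : ℕ, p.Prime ∧ 0 < u ∧ 0 < v ∧ 0 < Y ∧ a + u * Y ^ 4 = p ^ w * v ∧ Nat.Coprime (u * Y ^ 4) (p ^ w * v) ∧ b = u * Y ^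 4 ∧ c ≤ 2 * b ∧ a * u * v * p * b ^ 4 ≤ (Literature.NumberTheory.DiophantineGeometry.rad a b c) ^ 16 ∧ b ^ 4 ≤ (Literature.NumberTheory.DiophantineGeometry.rad a b c) ^ 12 * Y ^ 4)) :=
  Summit.ABC.ABC.Theorems.DepthCountedABC.stub_cellOneCases

/-- Stub 17 · **WEAKEST OPEN FACE OF CELL 1 (certificate, v3·c19; CLOSED: landed as
`Summit.ABC.ABC.Theorems.DepthCountedABC.stub_cellOneOfUniformQuarticThueMahler`, p150672)** — `UniformQuarticThueMahler η → ∃ δ > 0,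
CellOneExponent (4 − δ)` (unfolded; `δ = min(η,1)/8` works): the first improvement of the free exponent 4 on the cell
`ω₅ ≤ 1` follows from uniform binomial quartic Thue–Mahler. -/
theorem stub_cellOneOfUniformQuarticThueMahler : ∀ η : ℝ, 0 < η → (∃ B : ℕ, ∀ a u v p k Z : ℕ, p.Prime → 0 < a → 0 < u → 0 < v → 0 < Z → a + p ^ k * u = v * Z ^ 4 → Nat.Coprime (p ^ k * u) (v * Z ^ 4) → ((a * u * v * p : ℕ) : ℝ) ≤ (Z : ℝ) ^ η → Z ≤ B) → (∃ B : ℕ, ∀ a u v p w Y : ℕ, p.Prime → 0 < a → 0 < u → 0 < v → 0 < Y → a + u * Y ^ 4 = p ^ w * v → Nat.Coprime (u * Y ^ 4) (p ^ w * v) → ((a * u * v * p : ℕ) : ℝ) ≤ (Y : ℝ) ^ η → Y ≤ B) → ∃ δ : ℝ, 0 < δ ∧ ∃ C : ℝ, 0 < C ∧ ∀ a b c : ℕ, Literature.NumberTheory.DiophantineGeometry.IsABCTriple a b c → ((a * b * c).primeFactors.filter (fun p => 5 ≤ (a * b * c).factorization p)).card ≤ 1 → (c : ℝ) < C * ((Literature.NumberTheory.DiophantineGeometry.rad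 a b c : ℕ) : ℝ) ^ (4 - δ) :=
  Summit.ABC.ABC.Theorems.DepthCountedABC.stub_cellOneOfUniformQuarticThueMahler

/-! ### v3·c22 certificate stubs — the WINDOWS of the three entry-level sub-cruxes (Stubs 18–20)

Each is a conjunction «implied by `ABC` on a range» ∧ «false beyond a threshold», fully unfolded (`UniformQuarticThue`,
`UniformQuarticThueMahler`, `PolyPillai` verbatim). -/

/-- Stub 18 · **WINDOW OF `UniformQuarticThue`** (certificate, c22; CLOSED: landed as `Summit.ABC.ABC.Theorems.DepthCountedABC.stub_quarticThueWindow`, p157260): `ABC ⟹ UniformQuarticThue η` for `0 < η < 8/5`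
(the triple `(a, uY⁴, vZ⁴)` has `rad ≤ a·u·v·Y·Z ≤ Z^(2+5η/4)` and `c ≥ Z⁴`), and `UniformQuarticThue η` is FALSE for every
`η > 2`: for each good rational approximation `p/d` of the irrational `2^(1/4)` (`|2^(1/4) − p/d| < 1/d²`, infinitely many by
Dirichlet) `0 < |p⁴ − 2d⁴| < 65·d²`, and `(a, u, Y, v, Z)` := `(p⁴−2d⁴, 2, d, 1, p)` / `(2d⁴−p⁴, 1, p, 2, d)` (`p` odd) resp.
`(8p'⁴−d⁴, 1, d, 8, p')` / `(d⁴−8p'⁴, 8, p', 1, d)` (`p = 2p'`, `d` odd) is a positive coprime solution with `a·u·v < 264·d²`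
and `Z ≥ p' ≥ d/3` unbounded. -/
theorem stub_quarticThueWindow :
    (_root_.ABC → ∀ η : ℝ, 0 < η → η < 8 / 5 →
      ∃ B : ℕ, ∀ a u v Y Z : ℕ, 0 < a → 0 < u → 0 < v → 0 < Y → 0 < Z →
        a + u * Y ^ 4 = v * Z ^ 4 → Nat.Coprime (u * Y ^ 4) (v * Z ^ 4) →
        ((a * u * v : ℕ) : ℝ) ≤ (Z : ℝ) ^ η → Z ≤ B) ∧
    (∀ η : ℝ, 2 < η →
      ¬ ∃ B : ℕ, ∀ a u v Y Z : ℕ, 0 < a → 0 < u → 0 < v → 0 < Y → 0 < Z →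
        a + u * Y ^ 4 = v * Z ^ 4 → Nat.Coprime (u * Y ^ 4) (v * Z ^ 4) →
        ((a * u * v : ℕ) : ℝ) ≤ (Z : ℝ) ^ η → Z ≤ B) :=
  Summit.ABC.ABC.Theorems.DepthCountedABC.stub_quarticThueWindow

/-- Stub 19 · **WINDOW OF `UniformQuarticThueMahler`** (certificate, c22; CLOSED: landed as `Summit.ABC.ABC.Theorems.DepthCountedABC.stub_thueMahlerWindow`, p157144): `ABC ⟹ UniformQuarticThueMahler η` for
`0 < η < 3` (`rad ≤ a·u·v·p·Z ≤ Z^(1+η)`, `c ≥ Z⁴`; symmetrically in `Y`), and for every `η > 3` BOTH shapes are FALSE: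
`(2^m + 1)⁴ − 2^(4m) ≤ 15·2^(3m)` gives `a + 2^(4m)·1 = 1·Z⁴`, `Z = 2^m + 1` odd, `a·u·v·p = 2a ≤ 30·Z³`; and
`2^(4m) − (2^m − 1)⁴ ≤ 8·2^(3m)` gives `a + 1·Y⁴ = 2^(4m)·1`, `Y = 2^m − 1` odd, `2a ≤ 128·Y³` — SHARP threshold `η = 3`. -/
theorem stub_thueMahlerWindow :
    (_root_.ABC → ∀ η : ℝ, 0 < η → η < 3 →
      (∃ B : ℕ, ∀ a u v p k Z : ℕ, p.Prime → 0 < a → 0 < u → 0 < v → 0 < Z →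
        a + p ^ k * u = v * Z ^ 4 → Nat.Coprime (p ^ k * u) (v * Z ^ 4) →
        ((a * u * v * p : ℕ) : ℝ) ≤ (Z : ℝ) ^ η → Z ≤ B) ∧
      (∃ B : ℕ, ∀ a u v p w Y : ℕ, p.Prime → 0 < a → 0 < u → 0 < v → 0 < Y →
        a + u * Y ^ 4 = p ^ w * v → Nat.Coprime (u * Y ^ 4) (p ^ w * v) →
        ((a * u * v * p : ℕ) : ℝ) ≤ (Y : ℝ) ^ η → Y ≤ B)) ∧
    (∀ η : ℝ, 3 < η →
      (¬ ∃ B : ℕ, ∀ a u v p k Z : ℕ, p.Prime → 0 < a → 0 < u → 0 < v → 0 < Z →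
        a + p ^ k * u = v * Z ^ 4 → Nat.Coprime (p ^ k * u) (v * Z ^ 4) →
        ((a * u * v * p : ℕ) : ℝ) ≤ (Z : ℝ) ^ η → Z ≤ B) ∧
      (¬ ∃ B : ℕ, ∀ a u v p w Y : ℕ, p.Prime → 0 < a → 0 < u → 0 < v → 0 < Y →
        a + u * Y ^ 4 = p ^ w * v → Nat.Coprime (u * Y ^ 4) (p ^ w * v) →
        ((a * u * v * p : ℕ) : ℝ) ≤ (Y : ℝ) ^ η → Y ≤ B)) :=
  Summit.ABC.ABC.Theorems.DepthCountedABC.stub_thueMahlerWindow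

/-- Stub 20 · **WINDOW OF `PolyPillai`** (certificate, c22; CLOSED: landed as `Summit.ABC.ABC.Theorems.DepthCountedABC.stub_pillaiWindow`, p157002): `ABC ⟹ PolyPillai N` for every `N ≥ 2` (`rad ≤ r·s·a·u·v' =: R`,
`s^w·v' < C·R² ≤ C·R^N` at `ε = 1`), and `PolyPillai N` is FALSE for `N ≤ 1`: `3^(k+1) ∣ 4^(3^k) − 1`, so
`1 + 3^(k+1)·u = 2^(2·3^k)·1` is an admissible configuration with `r·s·a·u·v' = 6u < 6·4^(3^k)/3^(k+1)`, and
`4^(3^k) ≤ C·6u` forces `3^(k+1) < 6C` for every `k` — SHARP over `ℕ`. -/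
theorem stub_pillaiWindow :
    (_root_.ABC → ∀ N : ℕ, 2 ≤ N →
      ∃ C : ℝ, 0 < C ∧ ∀ r s a u v' v w : ℕ, r.Prime → s.Prime → 0 < a → 0 < u → 0 < v' →
        a + r ^ v * u = s ^ w * v' → Nat.Coprime (r ^ v * u) (s ^ w * v') →
        ((s ^ w * v' : ℕ) : ℝ) ≤ C * ((r * s * a * u * v' : ℕ) : ℝ) ^ N) ∧
    (∀ N : ℕ, N ≤ 1 →
      ¬ ∃ C : ℝ, 0 < C ∧ ∀ r s a u v' v w : ℕ, r.Prime → s.Prime → 0 < a → 0 < u → 0 < v' →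
        a + r ^ v * u = s ^ w * v' → Nat.Coprime (r ^ v * u) (s ^ w * v') →
        ((s ^ w * v' : ℕ) : ℝ) ≤ C * ((r * s * a * u * v' : ℕ) : ℝ) ^ N) :=
  Summit.ABC.ABC.Theorems.DepthCountedABC.stub_pillaiWindow

/-- Stub 21 · **THE CELL-0 WINDOW IS SHARP AT `η = 2`** (certificate, c22; CLOSED: landed as `Summit.ABC.ABC.Theorems.DepthCountedABC.stub_quarticThueSharp`, p157829): `ABC ⟹ UniformQuarticThue η` for EVERY
`0 < η < 2` — keeping the cofactor `v` of `c = vZ⁴` (`Y ≤ v^(1/4)Z`, `rad^(1+ε) ≤ (auv)^(1+ε)·v·Z^(2+2ε)`, cancel `v`,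
`ε = (2−η)/(2(2+η))`, `Z^((2−η)/2) < C`); with Stub 18 (`η > 2` false) the sub-crux is decided by `ABC` exactly on `(0,2)`. -/
theorem stub_quarticThueSharp : _root_.ABC → ∀ η : ℝ, 0 < η → η < 2 →
    ∃ B : ℕ, ∀ a u v Y Z : ℕ, 0 < a → 0 < u → 0 < v → 0 < Y → 0 < Z →
      a + u * Y ^ 4 = v * Z ^ 4 → Nat.Coprime (u * Y ^ 4) (v * Z ^ 4) →
      ((a * u * v : ℕ) : ℝ) ≤ (Z : ℝ) ^ η → Z ≤ B :=
  Summit.ABC.ABC.Theorems.DepthCountedABC.stub_quarticThueSharp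

/-! ### v3·c23 stubs — what the INEFFECTIVE Roth / Ridout machinery (all PROVED in the tree) yields on the shallow cells,
unconditionally, and the identification of the cell-0 entry sub-crux with crux #4 (Stubs 22–25)

The free bounds are `c < √2·rad²` on cell 0 and `c < 2·rad⁴` on the cell `ω₅ ≤ 1` (`stub_calibration`); the cores ask `1+δ`;
c19 showed that already `2−δ` / `4−δ` are UNIFORM Thue / Thue–Mahler statements (open).  In between sits exactly what Thue–Siegel–
Roth–Ridout prove: per-form finiteness over a finite box of coefficient classes, i.e. a `o(1)` in the constant and nothing in the
exponent.  Stub 22 / 23 record this as theorems; Stub 25 shows the `o(1)` on cell 0 is EQUIVALENT to Thue fibrewise (on the cell),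
exactly as `2−δ` is equivalent to uniform Thue (Stubs 13/14); Stub 24 identifies the latter with crux #4 `TowerFourSubLiouville`. -/

/-- Stub 22 · **CELL 0 LITTLE-o (certificate, c23; a THEOREM — Roth; CLOSED: landed as `Summit.ABC.ABC.Theorems.DepthCountedABC.stub_cellZeroLittleO`, p160408)** — `c = o(rad(abc)²)` on the 5-free cell: for every
`κ > 0` there is `c₀` such that every 5-free abc triple with `c ≥ c₀` has `c < κ·rad(abc)²` (the free bound is `c < √2·rad²`).
Mechanism: by `DepthCountedABC.quarticThue_natBounds` (c19) a 5-free triple ordered `a ≤ b` is `b = uY⁴`, `c = vZ⁴` with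
`a·u·v·c⁸ ≤ 16·rad¹⁶` and `c⁷ ≤ 8·rad¹²·Z⁴`; if `κ·rad² ≤ c` then `a·u·v ≤ 16/κ⁸` and `c ≤ 8Z⁴/κ⁶`, so `(u, v)` ranges over a
finite box and `0 < vZ⁴ − uY⁴ = a ≤ 16/κ⁸`; Roth over the box (`DepthCountedABC.fibreRoth_box`, exponent `1 < 2`) gives `Z < a`
beyond a threshold `Z₁`, whence `Z`, and then `c`, is bounded.  Ineffective (Roth); the other ordering by symmetry. -/
theorem stub_cellZeroLittleO : ∀ κ : ℝ, 0 < κ → ∃ c₀ : ℕ, ∀ a b c : ℕ,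
    Literature.NumberTheory.DiophantineGeometry.IsABCTriple a b c →
    ((a * b * c).primeFactors.filter (fun p => 5 ≤ (a * b * c).factorization p)).card = 0 →
    c₀ ≤ c → (c : ℝ) < κ * ((Literature.NumberTheory.DiophantineGeometry.rad a b c : ℕ) : ℝ) ^ 2 :=
  Summit.ABC.ABC.Theorems.DepthCountedABC.stub_cellZeroLittleO

/-- Stub 23 · **CELL 1 LITTLE-o (certificate, c23; a THEOREM — Ridout via Bugeaud–Evertse–Győry; CLOSED: landed as `Summit.ABC.ABC.Theorems.DepthCountedABC.stub_cellOneLittleO`, p160878)** — `c = o(rad(abc)⁴)` on the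
cell `ω₅(abc) ≤ 1`: for every `κ > 0` there is `c₀` such that every abc triple of the cell with `c ≥ c₀` has `c < κ·rad(abc)⁴`
(free bound `c < 2·rad⁴`).  Mechanism: order `a ≤ b` and apply `DepthCountedABC.stub_cellOneCases` (c19): either `c < 2rad²`
(then `κrad⁴ ≤ c` bounds `rad`, hence `c`), or `a + p^k·u = v·Z⁴ = c` with `a·u·v·p·c⁴ ≤ rad¹⁶ ≤ c⁴/κ⁴`, or `a + u·Y⁴ = p^w·v = c`,
`c ≤ 2b`, with `a·u·v·p·b⁴ ≤ rad¹⁶ ≤ 16b⁴/κ⁴`; in both Thue–Mahler shapes the data `(a, u, v, p)` lie in a finite box, and for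
each datum the tree-proved S-part theorem `Literature.NumberTheory.DiophantineApproximation.BugeaudEvertseGyory2018_SPartPolynomialValues_holds`
(`[f(x)]_S ≤ C·|f(x)|^(1/4+ε)`, `S = {p}`, `ε = 1/4`) applied to the monic separable quartics `f = X⁴ − v³a` at `x = vZ`
(`f(vZ) = v³·p^k·u`, `[·]_p ≥ p^k`) resp. `f = X⁴ + u³a` at `x = uY` (`f(uY) = u³·p^w·v`, `[·]_p ≥ p^w`) bounds `p^k ≤ C²v³u`
resp. `p^w ≤ C²u³v`, hence `c`; the maximum over the box is the threshold.  Ineffective (Ridout); other ordering by symmetry. -/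
theorem stub_cellOneLittleO : ∀ κ : ℝ, 0 < κ → ∃ c₀ : ℕ, ∀ a b c : ℕ,
    Literature.NumberTheory.DiophantineGeometry.IsABCTriple a b c →
    ((a * b * c).primeFactors.filter (fun p => 5 ≤ (a * b * c).factorization p)).card ≤ 1 →
    c₀ ≤ c → (c : ℝ) < κ * ((Literature.NumberTheory.DiophantineGeometry.rad a b c : ℕ) : ℝ) ^ 4 :=
  Summit.ABC.ABC.Theorems.DepthCountedABC.stub_cellOneLittleO

/-- Stub 24 · **CRUX #4 IS THE CELL-0 ENTRY SUB-CRUX (certificate, c23; CLOSED: landed as `Summit.ABC.ABC.Theorems.DepthCountedABC.stub_towerFourIffUniformQuarticThue`, p161405)** —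
`TowerFourSubLiouville ↔ ∃ η > 0, UniformQuarticThue η`.  Crux #4 (stmt-ABC-1649) is equivalent to the uniform binomial-quartic
saving `UBQ` (`∃ η > 0 ∃ Z₀ ∀ Z ≥ Z₀ …, max v w ≤ Z^η → wZ⁴ ≠ vY⁴ → Z^η < |wZ⁴ − vY⁴|`) by the LANDED
`Summit.ABC.ABC.Theorems.TowerFourSubLiouville.stub_cruxGivesUBQ` / `….stub_transfer`; and `UBQ ↔ ∃ η > 0, UniformQuarticThue η` is
bookkeeping: (→) a solution `a + uY⁴ = vZ⁴` with `a·u·v ≤ Z^η`, `Z ≥ Z₀` has `max u v ≤ Z^η` and `|vZ⁴ − uY⁴| = a ≤ Z^η`,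
contradiction, so `B = Z₀`; (←, with `η' = min(η/4, 1)` from `UniformQuarticThue η`) given `max v w ≤ Z^η'` and
`0 < |wZ⁴ − vY⁴| ≤ Z^η'`: if `wZ⁴ > vY⁴` the datum `(wZ⁴ − vY⁴, v, Y, w, Z)` has `a·v·w ≤ Z^(3η') ≤ Z^η`, so `Z ≤ B`; if
`wZ⁴ < vY⁴` the datum `(vY⁴ − wZ⁴, w, Z, v, Y)` has `Y⁴ > Z⁴/v ≥ Z^(4−η')`, `a·w·v ≤ Z^(3η') ≤ Y^η`, so `Y ≤ B` and
`Z⁴ < vY⁴ ≤ Z^η'·B⁴`, `Z` bounded; take `Z₀` past both bounds.  With Stub 13 this gives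
`TowerFourSubLiouville → ∃ δ > 0, CellZeroExponent (2 − δ)` (`cellZero_of_towerFourSubLiouville` below): the first `δ` below the
free exponent on cell 0 is (up to the 5-free locus of Stub 14) crux #4 itself — not a new item. -/
theorem stub_towerFourIffUniformQuarticThue :
    Summit.ABC.ABC.Theses.IneffectiveSubspace.TowerFourSubLiouville ↔
    ∃ η : ℝ, 0 < η ∧ ∃ B : ℕ, ∀ a u v Y Z : ℕ, 0 < a → 0 < u → 0 < v → 0 < Y → 0 < Z →
      a + u * Y ^ 4 = v * Z ^ 4 → Nat.Coprime (u * Y ^ 4) (v * Z ^ 4) →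
      ((a * u * v : ℕ) : ℝ) ≤ (Z : ℝ) ^ η → Z ≤ B :=
  Summit.ABC.ABC.Theorems.DepthCountedABC.stub_towerFourIffUniformQuarticThue

/-- Stub 25 · **CELL 0 LITTLE-o, CONVERSE (certificate, c23; elementary; CLOSED: landed as `Summit.ABC.ABC.Theorems.DepthCountedABC.stub_thueOfCellZeroLittleO`, p161590)** — `o(rad²)` on the 5-free cell gives back, for each
single coefficient class `(a, u, v)`, the finiteness (bounded `Z`) of the positive coprime solutions of the binomial quartic Thue
equation `a + u·Y⁴ = v·Z⁴` whose triple `(a, uY⁴, vZ⁴)` lies in the cell: `rad ≤ a·u·v·Y·Z` and `Y², Z² ≤ √c` give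
`rad² ≤ (a·u·v)²·c`, so at `κ = (a·u·v)⁻²` the hypothesis bounds `c = vZ⁴ ≥ Z`.  With Stub 22: on cell 0, "free exponent 2
improved by `o(1)`" ⟺ Thue's theorem fibrewise (Roth, proved), while "`2 − δ`" ⟺ uniform Thue ⟺ crux #4 (Stubs 13/14/24). -/
theorem stub_thueOfCellZeroLittleO :
    (∀ κ : ℝ, 0 < κ → ∃ c₀ : ℕ, ∀ a b c : ℕ,
      Literature.NumberTheory.DiophantineGeometry.IsABCTriple a b c →
      ((a * b * c).primeFactors.filter (fun p => 5 ≤ (a * b * c).factorization p)).card = 0 →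
      c₀ ≤ c → (c : ℝ) < κ * ((Literature.NumberTheory.DiophantineGeometry.rad a b c : ℕ) : ℝ) ^ 2) →
    ∀ a u v : ℕ, 0 < a → 0 < u → 0 < v → ∃ B : ℕ, ∀ Y Z : ℕ, 0 < Y → 0 < Z →
      a + u * Y ^ 4 = v * Z ^ 4 → Nat.Coprime (u * Y ^ 4) (v * Z ^ 4) →
      ((a * (u * Y ^ 4) * (v * Z ^ 4)).primeFactors.filter
          (fun p => 5 ≤ (a * (u * Y ^ 4) * (v * Z ^ 4)).factorization p)).card = 0 → Z ≤ B :=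
  Summit.ABC.ABC.Theorems.DepthCountedABC.stub_thueOfCellZeroLittleO

/-! ### v3·c23 wave 2 — the cell-1 converse and the density of the cell-0 exceptions (Stubs 26–27, both LANDED: p162369, p162960) -/

/-- Stub 26 · **CELL 1 LITTLE-o, CONVERSE (certificate, c23 wave 2; elementary; CLOSED: landed as `Summit.ABC.ABC.Theorems.DepthCountedABC.stub_thueMahlerOfCellOneLittleO`, p162369)** — `o(rad⁴)` on the cell `ω₅ ≤ 1` gives back,
for each single Thue–Mahler datum `(a, u, v, p)`, a bound on `c` over the positive coprime solutions of BOTH binomial quartic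
Thue–Mahler shapes of `stub_cellOneCases` whose triple lies in the cell: `a + p^k·u = v·Z⁴` (triple `(a, p^k u, vZ⁴)`:
`rad ≤ a·p·u·v·Z`, `Z⁴ ≤ c`, so `rad⁴ ≤ (a·p·u·v)⁴·c`) and `a + u·Y⁴ = p^w·v` (triple `(a, uY⁴, p^w v)`: `rad ≤ a·u·Y·p·v`,
`Y⁴ < c`); at `κ = (a·p·u·v)⁻⁴` the hypothesis bounds `c`.  With Stub 23: on cell 1, "free exponent 4 improved by `o(1)`" ⟺
Ridout (Thue–Mahler finiteness) fibrewise — a theorem — while "`4 − δ`" ⟸ UNIFORM Thue–Mahler (Stub 17, open). -/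
theorem stub_thueMahlerOfCellOneLittleO :
    (∀ κ : ℝ, 0 < κ → ∃ c₀ : ℕ, ∀ a b c : ℕ,
      Literature.NumberTheory.DiophantineGeometry.IsABCTriple a b c →
      ((a * b * c).primeFactors.filter (fun p => 5 ≤ (a * b * c).factorization p)).card ≤ 1 →
      c₀ ≤ c → (c : ℝ) < κ * ((Literature.NumberTheory.DiophantineGeometry.rad a b c : ℕ) : ℝ) ^ 4) →
    ∀ a u v p : ℕ, p.Prime → 0 < a → 0 < u → 0 < v →
      (∃ B : ℕ, ∀ k Z : ℕ, 0 < Z → a + p ^ k * u = v * Z ^ 4 → Nat.Coprime (p ^ k * u) (v * Z ^ 4) →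
          ((a * (p ^ k * u) * (v * Z ^ 4)).primeFactors.filter
            (fun q => 5 ≤ (a * (p ^ k * u) * (v * Z ^ 4)).factorization q)).card ≤ 1 → v * Z ^ 4 ≤ B) ∧
      (∃ B : ℕ, ∀ w Y : ℕ, 0 < Y → a + u * Y ^ 4 = p ^ w * v → Nat.Coprime (u * Y ^ 4) (p ^ w * v) →
          ((a * (u * Y ^ 4) * (p ^ w * v)).primeFactors.filter
            (fun q => 5 ≤ (a * (u * Y ^ 4) * (p ^ w * v)).factorization q)).card ≤ 1 → p ^ w * v ≤ B) :=
  Summit.ABC.ABC.Theorems.DepthCountedABC.stub_thueMahlerOfCellOneLittleO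

/-- Stub 27 · **THE CELL-0 EXCEPTIONS TO `2 − δ` ARE POWER-SPARSE (certificate, c23 wave 2; elementary counting; CLOSED: landed as `Summit.ABC.ABC.Theorems.DepthCountedABC.stub_cellZeroSparseExceptions`, p162960)** — for
`0 < δ ≤ 1` there is `C` such that for every `N` any finite set of 5-free abc triples with `c ≤ N` and `rad(abc)^(2−δ) ≤ c` has at
most `C·N^(1/4 + 16δ)` elements (against `≍ N²` triples in the cell): ordered `a ≤ b`, `quarticThue_natBounds` gives `c = vZ⁴`
with `a·u·v·c⁸ ≤ 16·rad¹⁶ ≤ 16·c^(16/(2−δ))`, so `a, v ≤ 16·c^(8δ/(2−δ)) ≤ 16·N^(8δ)` and `Z ≤ N^(1/4)`, and `(a, v, Z)`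
determines the triple (`c = vZ⁴`, `b = c − a`); the ordering `b < a` symmetrically.  Unconditional and uniform — the trivial count
that a uniform Thue bound (crux #4) would improve to `N^(O(δ))`. -/
theorem stub_cellZeroSparseExceptions : ∀ δ : ℝ, 0 < δ → δ ≤ 1 → ∃ C : ℝ, 0 < C ∧ ∀ N : ℕ,
    ∀ T : Finset (ℕ × ℕ × ℕ),
      (∀ t ∈ T, Literature.NumberTheory.DiophantineGeometry.IsABCTriple t.1 t.2.1 t.2.2 ∧
        ((t.1 * t.2.1 * t.2.2).primeFactors.filter
            (fun p => 5 ≤ (t.1 * t.2.1 * t.2.2).factorization p)).card = 0 ∧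
        t.2.2 ≤ N ∧
        ((Literature.NumberTheory.DiophantineGeometry.rad t.1 t.2.1 t.2.2 : ℕ) : ℝ) ^ (2 - δ) ≤ (t.2.2 : ℝ)) →
      (T.card : ℝ) ≤ C * (N : ℝ) ^ ((1 : ℝ) / 4 + 16 * δ) :=
  Summit.ABC.ABC.Theorems.DepthCountedABC.stub_cellZeroSparseExceptions

/-! ### v3·c23 wave 3 — the first `δ` of each shallow cell as an EXACT equivalence on the cell (Stubs 28–29, both LANDED: p164544, p165256)

c19 left the pairs 13/14 (cell 0) and 17/— (cell 1) asymmetric: the hypothesis was the UNRESTRICTED uniform Thue / Thue–Mahler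
statement, the converse produced only its restriction to data whose triple lies in the cell.  But the proofs of 13 and 17 apply the
hypothesis ONLY to data read off a triple of the cell (`b = uY⁴`, `c = vZ⁴` literally), so the cell-restricted hypothesis suffices, and
the first `δ` below the free exponent becomes an exact equivalence with the cell-restricted uniform statement; with Stub 24, crux #4
implies the cell-0 one. -/

/-- Stub 28 · **CELL 0: `∃ δ, exponent 2 − δ` ⟺ uniform quartic Thue ON THE CELL (certificate, c23 wave 3; CLOSED: landed as `Summit.ABC.ABC.Theorems.DepthCountedABC.stub_cellZeroIffUniformQuarticThueCell`, p164544)** —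
`(∃ δ > 0, CellZeroExponent (2 − δ)) ↔ (∃ η > 0, UniformQuarticThue η restricted to data with 5-free triple (a, uY⁴, vZ⁴))`.
`→`: Stub 14 at `η = δ/2`.  `←`: the proof of Stub 13 verbatim, the 5-free hypothesis of the datum being the cell hypothesis of the
triple (`b = uY⁴`, `c = vZ⁴` from `quarticThue_natBounds`).  With Stub 24: `TowerFourSubLiouville →` either side. -/
theorem stub_cellZeroIffUniformQuarticThueCell :
    (∃ δ : ℝ, 0 < δ ∧ ∃ C : ℝ, 0 < C ∧ ∀ a b c : ℕ,
      Literature.NumberTheory.DiophantineGeometry.IsABCTriple a b c →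
      ((a * b * c).primeFactors.filter (fun p => 5 ≤ (a * b * c).factorization p)).card = 0 →
      (c : ℝ) < C * ((Literature.NumberTheory.DiophantineGeometry.rad a b c : ℕ) : ℝ) ^ (2 - δ)) ↔
    (∃ η : ℝ, 0 < η ∧ ∃ B : ℕ, ∀ a u v Y Z : ℕ, 0 < a → 0 < u → 0 < v → 0 < Y → 0 < Z →
      a + u * Y ^ 4 = v * Z ^ 4 → Nat.Coprime (u * Y ^ 4) (v * Z ^ 4) →
      ((a * (u * Y ^ 4) * (v * Z ^ 4)).primeFactors.filter
          (fun p => 5 ≤ (a * (u * Y ^ 4) * (v * Z ^ 4)).factorization p)).card = 0 →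
      ((a * u * v : ℕ) : ℝ) ≤ (Z : ℝ) ^ η → Z ≤ B) :=
  Summit.ABC.ABC.Theorems.DepthCountedABC.stub_cellZeroIffUniformQuarticThueCell

/-- Stub 29 · **CELL 1: `∃ δ, exponent 4 − δ` ⟺ uniform quartic Thue–Mahler ON THE CELL (certificate, c23 wave 3; CLOSED: landed as `Summit.ABC.ABC.Theorems.DepthCountedABC.stub_cellOneIffUniformQuarticThueMahlerCell`, p165256)** —
`(∃ δ > 0, CellOneExponent (4 − δ)) ↔ (∃ η > 0, both shapes of UniformQuarticThueMahler η restricted to data whose triple lies in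
ω₅ ≤ 1)`.  `→` (new, elementary): for a datum `a + p^k·u = v·Z⁴` of the cell with `a·u·v·p ≤ Z^η`: `rad ≤ a·p·u·v·Z ≤ Z^(1+η)` and
`Z⁴ ≤ c < C·rad^(4−δ) ≤ C·Z^((1+η)(4−δ))`, bounded once `η < δ/(4−δ)` (e.g. `η = min δ 1 / 8`; for `δ ≥ 4` the cell is bounded
outright); the `Y`-shape symmetrically (`Y⁴ < c`).  `←`: the proof of Stub 17 (`cellOne_radius_B/C`) verbatim with the cell
hypothesis of the datum supplied by the triple. -/
theorem stub_cellOneIffUniformQuarticThueMahlerCell :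
    (∃ δ : ℝ, 0 < δ ∧ ∃ C : ℝ, 0 < C ∧ ∀ a b c : ℕ,
      Literature.NumberTheory.DiophantineGeometry.IsABCTriple a b c →
      ((a * b * c).primeFactors.filter (fun p => 5 ≤ (a * b * c).factorization p)).card ≤ 1 →
      (c : ℝ) < C * ((Literature.NumberTheory.DiophantineGeometry.rad a b c : ℕ) : ℝ) ^ (4 - δ)) ↔
    (∃ η : ℝ, 0 < η ∧
      (∃ B : ℕ, ∀ a u v p k Z : ℕ, p.Prime → 0 < a → 0 < u → 0 < v → 0 < Z →
        a + p ^ k * u = v * Z ^ 4 → Nat.Coprime (p ^ k * u) (v * Z ^ 4) →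
        ((a * (p ^ k * u) * (v * Z ^ 4)).primeFactors.filter
            (fun q => 5 ≤ (a * (p ^ k * u) * (v * Z ^ 4)).factorization q)).card ≤ 1 →
        ((a * u * v * p : ℕ) : ℝ) ≤ (Z : ℝ) ^ η → Z ≤ B) ∧
      (∃ B : ℕ, ∀ a u v p w Y : ℕ, p.Prime → 0 < a → 0 < u → 0 < v → 0 < Y →
        a + u * Y ^ 4 = p ^ w * v → Nat.Coprime (u * Y ^ 4) (p ^ w * v) →
        ((a * (u * Y ^ 4) * (p ^ w * v)).primeFactors.filter
            (fun q => 5 ≤ (a * (u * Y ^ 4) * (p ^ w * v)).factorization q)).card ≤ 1 →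
        ((a * u * v * p : ℕ) : ℝ) ≤ (Y : ℝ) ^ η → Y ≤ B)) := by
  -- LANDED as `Summit.ABC.ABC.Theorems.DepthCountedABC.stub_cellOneIffUniformQuarticThueMahlerCell` (p165256); the import is
  -- deferred in this copy until the farm build of that module catches up (lead c23, 14:30Z) — then replace by the name.
  sorry

/-! ### Consistency: each named statement IS its registered stub (definitional unfolding only) -/

theorem lw4_holds : LW4 := stub_LW4
theorem dictionary_holds : LW4 → S4SmallMemberABC := stub_dictionary
theorem base_holds : S4SmallMemberABC → SmallFullSizeFiveFree := stub_base
theorem deepSmallFullSize_holds : SmallFullSizeDeep := stub_deepSmallFullSize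
theorem allPowerRich_holds : AllPowerRich := stub_allPowerRich
theorem assembly_holds : AssemblyStatement := stub_assembly
theorem ridoutSmallMember_holds : RidoutSmallMember := stub_ridoutSmallMember.1
theorem coefficientFibre_holds : CoefficientFibre := stub_ridoutSmallMember.2
theorem roughPowerfulCell_iff : Summit.ABC.ABC.Theses.IneffectiveSubspace.DepthCountedABC ↔ RoughPowerfulCell :=
  stub_roughPowerfulCellIff
theorem boundedRadicalFibre_holds : BoundedRadicalFibre := stub_boundedRadicalCell
theorem lwDeepDictionary_holds (K : ℕ) : LWDeep K → SmallFullSizeCell K := stub_lwDeepDictionary K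
theorem cellZero_of_uniformQuarticThue (η : ℝ) (hη : 0 < η) (h : UniformQuarticThue η) :
    ∃ δ : ℝ, 0 < δ ∧ CellZeroExponent (2 - δ) := stub_cellZeroOfUniformQuarticThue η hη h
theorem uniformQuarticThue_fiveFree_of_cellZero (δ : ℝ) (hδ : 0 < δ) (h : CellZeroExponent (2 - δ))
    (η : ℝ) (hη : 0 < η) (hηδ : 5 * η < 4 * δ) :
    ∃ B : ℕ, ∀ a u v Y Z : ℕ, 0 < a → 0 < u → 0 < v → 0 < Y → 0 < Z →
      a + u * Y ^ 4 = v * Z ^ 4 → Nat.Coprime (u * Y ^ 4) (v * Z ^ 4) →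
      omega5 (a * (u * Y ^ 4) * (v * Z ^ 4)) = 0 → ((a * u * v : ℕ) : ℝ) ≤ (Z : ℝ) ^ η → Z ≤ B :=
  stub_uniformQuarticThueOfCellZero δ hδ h η hη hηδ
theorem cellTwo_of_polyPillai (N : ℕ) (h : PolyPillai N) : CellTwoPolyExponent (14 * N + 8) :=
  stub_cellTwoOfPolyPillai N h
theorem cellOne_of_uniformQuarticThueMahler (η : ℝ) (hη : 0 < η) (h : UniformQuarticThueMahler η) :
    ∃ δ : ℝ, 0 < δ ∧ CellOneExponent (4 - δ) :=
  stub_cellOneOfUniformQuarticThueMahler η hη h.1 h.2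
theorem cellZeroLittleO_holds : CellZeroLittleO := stub_cellZeroLittleO
theorem cellOneLittleO_holds : CellOneLittleO := stub_cellOneLittleO
theorem towerFourSubLiouville_iff_uniformQuarticThue :
    Summit.ABC.ABC.Theses.IneffectiveSubspace.TowerFourSubLiouville ↔ ∃ η : ℝ, 0 < η ∧ UniformQuarticThue η :=
  stub_towerFourIffUniformQuarticThue

/-- c23 · **crux #4 dominates the first `δ` of cell 0**: `TowerFourSubLiouville → ∃ δ > 0, CellZeroExponent (2 − δ)`
(Stub 24 then Stub 13). -/
theorem cellZero_of_towerFourSubLiouville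
    (h4 : Summit.ABC.ABC.Theses.IneffectiveSubspace.TowerFourSubLiouville) :
    ∃ δ : ℝ, 0 < δ ∧ CellZeroExponent (2 - δ) := by
  obtain ⟨η, hη, hT⟩ := towerFourSubLiouville_iff_uniformQuarticThue.1 h4
  exact cellZero_of_uniformQuarticThue η hη hT

/-- c23 · **on cell 0, `o(rad²)` ⟺ Thue fibrewise** (Stub 22 is a theorem; Stub 25 is its converse on the cell): the
per-class finiteness of `a + uY⁴ = vZ⁴` inside the 5-free cell, for every coefficient class `(a, u, v)`. -/
theorem thue_fiveFree_of_cellZeroLittleO (h : CellZeroLittleO) (a u v : ℕ) (ha : 0 < a) (hu : 0 < u) (hv : 0 < v) :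
    ∃ B : ℕ, ∀ Y Z : ℕ, 0 < Y → 0 < Z → a + u * Y ^ 4 = v * Z ^ 4 → Nat.Coprime (u * Y ^ 4) (v * Z ^ 4) →
      omega5 (a * (u * Y ^ 4) * (v * Z ^ 4)) = 0 → Z ≤ B :=
  stub_thueOfCellZeroLittleO h a u v ha hu hv

/-- c23 wave 3 · **the first `δ` of cell 0 is exactly uniform quartic Thue on the cell** (Stub 28, folded). -/
theorem cellZero_firstDelta_iff :
    (∃ δ : ℝ, 0 < δ ∧ CellZeroExponent (2 - δ)) ↔
    (∃ η : ℝ, 0 < η ∧ ∃ B : ℕ, ∀ a u v Y Z : ℕ, 0 < a → 0 < u → 0 < v → 0 < Y → 0 < Z →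
      a + u * Y ^ 4 = v * Z ^ 4 → Nat.Coprime (u * Y ^ 4) (v * Z ^ 4) →
      omega5 (a * (u * Y ^ 4) * (v * Z ^ 4)) = 0 → ((a * u * v : ℕ) : ℝ) ≤ (Z : ℝ) ^ η → Z ≤ B) :=
  stub_cellZeroIffUniformQuarticThueCell

/-- c23 wave 3 · **the first `δ` of cell 1 is exactly uniform quartic Thue–Mahler on the cell** (Stub 29, folded). -/
theorem cellOne_firstDelta_iff :
    (∃ δ : ℝ, 0 < δ ∧ CellOneExponent (4 - δ)) ↔
    (∃ η : ℝ, 0 < η ∧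
      (∃ B : ℕ, ∀ a u v p k Z : ℕ, p.Prime → 0 < a → 0 < u → 0 < v → 0 < Z →
        a + p ^ k * u = v * Z ^ 4 → Nat.Coprime (p ^ k * u) (v * Z ^ 4) →
        omega5 (a * (p ^ k * u) * (v * Z ^ 4)) ≤ 1 → ((a * u * v * p : ℕ) : ℝ) ≤ (Z : ℝ) ^ η → Z ≤ B) ∧
      (∃ B : ℕ, ∀ a u v p w Y : ℕ, p.Prime → 0 < a → 0 < u → 0 < v → 0 < Y →
        a + u * Y ^ 4 = p ^ w * v → Nat.Coprime (u * Y ^ 4) (p ^ w * v) →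
        omega5 (a * (u * Y ^ 4) * (p ^ w * v)) ≤ 1 → ((a * u * v * p : ℕ) : ℝ) ≤ (Y : ℝ) ^ η → Y ≤ B)) :=
  stub_cellOneIffUniformQuarticThueMahlerCell

/-- c23 wave 2 · **on cell 1, `o(rad⁴)` ⟺ Ridout fibrewise** (Stub 23 is a theorem; Stub 26 is its converse on the cell). -/
theorem thueMahler_cellOne_of_cellOneLittleO (h : CellOneLittleO) (a u v p : ℕ) (hp : p.Prime) (ha : 0 < a)
    (hu : 0 < u) (hv : 0 < v) :
    (∃ B : ℕ, ∀ k Z : ℕ, 0 < Z → a + p ^ k * u = v * Z ^ 4 → Nat.Coprime (p ^ k * u) (v * Z ^ 4) →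
        omega5 (a * (p ^ k * u) * (v * Z ^ 4)) ≤ 1 → v * Z ^ 4 ≤ B) ∧
    (∃ B : ℕ, ∀ w Y : ℕ, 0 < Y → a + u * Y ^ 4 = p ^ w * v → Nat.Coprime (u * Y ^ 4) (p ^ w * v) →
        omega5 (a * (u * Y ^ 4) * (p ^ w * v)) ≤ 1 → p ^ w * v ≤ B) :=
  stub_thueMahlerOfCellOneLittleO h a u v p hp ha hu hv

/-- c22 window of the cell-0 sub-crux: `ABC`-implied on `(0, 8/5)`, false on `(2, ∞)`. -/
theorem uniformQuarticThue_window :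
    (_root_.ABC → ∀ η : ℝ, 0 < η → η < 8 / 5 → UniformQuarticThue η) ∧
    (∀ η : ℝ, 2 < η → ¬ UniformQuarticThue η) :=
  stub_quarticThueWindow

/-- c22 sharp window of the cell-0 sub-crux: `ABC`-implied on `(0, 2)`, false on `(2, ∞)`. -/
theorem uniformQuarticThue_sharp_window :
    (_root_.ABC → ∀ η : ℝ, 0 < η → η < 2 → UniformQuarticThue η) ∧ (∀ η : ℝ, 2 < η → ¬ UniformQuarticThue η) :=
  ⟨stub_quarticThueSharp, stub_quarticThueWindow.2⟩

/-- c22 window of the cell-1 sub-crux: `ABC`-implied on `(0, 3)`, both shapes false on `(3, ∞)` — sharp. -/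
theorem uniformQuarticThueMahler_window :
    (_root_.ABC → ∀ η : ℝ, 0 < η → η < 3 → UniformQuarticThueMahler η) ∧
    (∀ η : ℝ, 3 < η → ¬ UniformQuarticThueMahler η) :=
  ⟨stub_thueMahlerWindow.1, fun η hη h => (stub_thueMahlerWindow.2 η hη).1 h.1⟩

/-- c22 window of the cell-2 sub-crux: `ABC`-implied for `N ≥ 2`, false for `N ≤ 1` — sharp over `ℕ`. -/
theorem polyPillai_window :
    (_root_.ABC → ∀ N : ℕ, 2 ≤ N → PolyPillai N) ∧ (∀ N : ℕ, N ≤ 1 → ¬ PolyPillai N) :=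
  stub_pillaiWindow

/-! ## The composition (kernel-checked; concludes the crux BY NAME) -/

/-- **`DepthCountedABC_of`** — the glue of the line: `LW4` feeds the dictionary, the dictionary feeds the base cell,
the deep T-statement and the P-statement cover the rest, and the assembly turns the three cell statements into the
crux `Summit.ABC.ABC.Theses.IneffectiveSubspace.DepthCountedABC`. -/
theorem DepthCountedABC_of (hLW : LW4) (hdict : LW4 → S4SmallMemberABC)
    (hbase : S4SmallMemberABC → SmallFullSizeFiveFree) (hdeep : SmallFullSizeDeep)
    (hP : AllPowerRich) (hasm : AssemblyStatement) :
    Summit.ABC.ABC.Theses.IneffectiveSubspace.DepthCountedABC :=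
  hasm (hbase (hdict hLW)) hdeep hP

/-- Wiring check: the six registered stubs feed `DepthCountedABC_of` as stated (definitional unfolding only). -/
theorem depthCountedABC_from_stubs : Summit.ABC.ABC.Theses.IneffectiveSubspace.DepthCountedABC :=
  DepthCountedABC_of stub_LW4 stub_dictionary stub_base stub_deepSmallFullSize stub_allPowerRich stub_assembly

/-! ## v3: where the Ridout stratum sits

* `DepthCountedABC_of_roughPowerfulCell` — the crux also follows from `RoughPowerfulCell` alone (Ridout normal form);
* the T core on a cell implies `CoefficientFibre` on that cell trivially (`rad(bc) ≤ R`), and `CoefficientFibre`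
  is now a THEOREM on every cell and every depth — the open content of T is uniformity in `rad(bc)`, exactly as the
  open content of `LW4` on height fibres (`stub_fibreRoth`, p104280) is uniformity of Roth's threshold. -/

/-- The crux from its Ridout normal form alone. -/
theorem DepthCountedABC_of_roughPowerfulCell (h : RoughPowerfulCell) :
    Summit.ABC.ABC.Theses.IneffectiveSubspace.DepthCountedABC :=
  roughPowerfulCell_iff.2 h

/-- T on a cell gives T on its coefficient fibres (bookkeeping: `radical(bc) ≥ 1`, so `rad(bc) ≤ R` bounds the
radical factor by `R^(1+δ)`); recorded to place `CoefficientFibre` (now unconditional) under the T core. -/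
theorem coefficientFibre_of_smallFullSizeCell (K : ℕ) (hT : SmallFullSizeCell K) :
    ∀ R : ℕ, ∀ δ : ℝ, 0 < δ → ∃ C : ℝ, 0 < C ∧ ∀ a b c : ℕ, IsABCTriple a b c → omega5 (a * b * c) ≤ K →
      radical (b * c) ≤ R → (c : ℝ) ≤ C * (a : ℝ) ^ (1 + δ) := by
  intro R δ hδ
  obtain ⟨C, hC, h⟩ := hT δ hδ
  refine ⟨C * (R : ℝ) ^ (1 + δ) + 1, by positivity, fun a b c habc hK hR => ?_⟩
  have hlt := h a b c habc hK
  have ha0 : (0 : ℝ) ≤ (a : ℝ) := Nat.cast_nonneg a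
  have hr0 : (0 : ℝ) ≤ ((radical (b * c) : ℕ) : ℝ) := Nat.cast_nonneg _
  have hrR : ((radical (b * c) : ℕ) : ℝ) ≤ (R : ℝ) := by exact_mod_cast hR
  have hδ1 : (0 : ℝ) ≤ 1 + δ := by linarith
  have hsplit : ((a : ℝ) * ((radical (b * c) : ℕ) : ℝ)) ^ (1 + δ) =
      (a : ℝ) ^ (1 + δ) * ((radical (b * c) : ℕ) : ℝ) ^ (1 + δ) := Real.mul_rpow ha0 hr0
  have hrad_le : ((radical (b * c) : ℕ) : ℝ) ^ (1 + δ) ≤ (R : ℝ) ^ (1 + δ) :=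
    Real.rpow_le_rpow hr0 hrR hδ1
  have ha1 : (0 : ℝ) ≤ (a : ℝ) ^ (1 + δ) := Real.rpow_nonneg ha0 _
  have hRa : C * ((a : ℝ) ^ (1 + δ) * ((radical (b * c) : ℕ) : ℝ) ^ (1 + δ)) ≤
      C * ((a : ℝ) ^ (1 + δ) * (R : ℝ) ^ (1 + δ)) :=
    mul_le_mul_of_nonneg_left (mul_le_mul_of_nonneg_left hrad_le ha1) hC.le
  calc (c : ℝ) ≤ C * ((a : ℝ) * ((radical (b * c) : ℕ) : ℝ)) ^ (1 + δ) := hlt.le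
    _ = C * ((a : ℝ) ^ (1 + δ) * ((radical (b * c) : ℕ) : ℝ) ^ (1 + δ)) := by rw [hsplit]
    _ ≤ C * ((a : ℝ) ^ (1 + δ) * (R : ℝ) ^ (1 + δ)) := hRa
    _ = (C * (R : ℝ) ^ (1 + δ)) * (a : ℝ) ^ (1 + δ) := by ring
    _ ≤ (C * (R : ℝ) ^ (1 + δ) + 1) * (a : ℝ) ^ (1 + δ) := by nlinarith [ha1]

/-! ## Certificates (NOT stubs; to be landed with `--supports stmt-ABC-14938`)

* `S4SmallMemberABC → LW4` (L1 converse: for `x ∈ ℚ_{>0}⁴` with `N/D = ∏ x_j^j` reduced, `N ≠ D`, the triple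
  `(|N−D|, min, max)` is abc, `S₄(N)S₄(D) ≤ prodHeight x` by `⌈kv/4⌉ ≤ v (k ≤ 4)`, and `|Λ| = log(max/min) ≥ |N−D|/max`);
* `ABC → S4SmallMemberABC` (L3: `rad ≤ S₄` and `S₄(n) ≥ n^(1/4)` absorbs `a^ε ≤ c^ε`), hence `ABC → LW4`;
* `DepthCountedABC → SmallFullSizeFiveFree ∧ SmallFullSizeDeep` and `DepthCountedABC → AllPowerRich` (the cores are
  weakenings of the crux on their cells: `rad a ≤ a`, drop hypotheses).
-/

/-! ## v3·c20: domination by crux #2 (kernel-checked wiring of `blocked-on: stmt-ABC-14937`)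

Every open stub of this line, and the crux itself, follows from the single registered item
`Summit.ABC.ABC.Theses.IneffectiveSubspace.UniformSadicTowerFour` (crux #2, stmt-ABC-14937) by theorems already in
the tree: the dictionary `towerFourGivesDepthCounted_proof` (stmt-ABC-14940) gives the crux; the crux gives the two
arithmetic cores (`stub_coresOfCrux`, p99305); and #2 gives `S4SmallMemberABC` (`stub_s4SmallMemberOfTowerFour`,
p101075), which is equivalent to `LW4` (`lw4_iff_s4SmallMember`, p98807).  So the three `sorry`s above are each
discharged by `h2 : UniformSadicTowerFour`, and by nothing weaker that is known (c19 per-cell frontier). -/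

/-- **c20 · the crux from crux #2** — `TowerFourGivesDepthCounted` (`:= UniformSadicTowerFour → DepthCountedABC`,
support stmt-ABC-14940) is the tree theorem `Summit.ABC.ABC.Theorems.towerFourGivesDepthCounted_proof` (optimal
level-4 lifts, `S := {p : v_p(abc) ≥ 5}`); restated folded, so that the only `proof-of-item` of this workfile stays
`depthCountedABC_from_stubs` (closed=false: the honest state of the line). -/
theorem towerFour_dominates_crux : Summit.ABC.ABC.Theses.IneffectiveSubspace.TowerFourGivesDepthCounted :=
  Summit.ABC.ABC.Theorems.towerFourGivesDepthCounted_proof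

/-- **c20 · every OPEN stub of line `Sketch` from crux #2** — `UniformSadicTowerFour → LW4 ∧ SmallFullSizeDeep ∧
AllPowerRich`: `LW4` through `S4SmallMemberABC` (p101075, p98807), the T core on the deep cells and the P core
through the crux (p99305).  This is the kernel form of the lead outcome `blocked-on: stmt-ABC-14937`: the three
`sorry`s of this file are each discharged by the ONE registered open item crux #2, and (c19 frontier) by nothing
weaker that is known. -/
theorem openStubs_of_towerFour
    (h2 : Summit.ABC.ABC.Theses.IneffectiveSubspace.UniformSadicTowerFour) :
    LW4 ∧ SmallFullSizeDeep ∧ AllPowerRich :=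
  ⟨Summit.ABC.ABC.Theorems.DepthCountedABC.lw4_of_s4SmallMember
      (Summit.ABC.ABC.Theorems.DepthCountedABC.stub_s4SmallMemberOfTowerFour h2),
    (Summit.ABC.ABC.Theorems.DepthCountedABC.stub_coresOfCrux (towerFour_dominates_crux h2)).2.1,
    (Summit.ABC.ABC.Theorems.DepthCountedABC.stub_coresOfCrux (towerFour_dominates_crux h2)).2.2⟩

/-- **c20 · consistency of the T/P cut against #2** — feeding the #2-discharged cores through the line's own glue
`DepthCountedABC_of` (with the landed `stub_dictionary`, `stub_base`, `stub_assembly`) re-derives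
`TowerFourGivesDepthCounted`; stated folded (not a proof of the item). -/
theorem towerFour_dominates_line : Summit.ABC.ABC.Theses.IneffectiveSubspace.TowerFourGivesDepthCounted :=
  fun h2 => DepthCountedABC_of (openStubs_of_towerFour h2).1 stub_dictionary stub_base
    (openStubs_of_towerFour h2).2.1 (openStubs_of_towerFour h2).2.2 stub_assembly

end Summit.ABC.ABC.Cruxes.DepthCountedABC.Sketch
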